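import Mathlib
import Literature.MathematicalPhysics.QuantumFieldTheory.Balaban1983to89.B15Ineq147LevelGap
import Literature.MathematicalPhysics.QuantumFieldTheory.Balaban1983to89.B11SectG
import Literature.MathematicalPhysics.QuantumFieldTheory.Balaban1983to89.B6Lemma21Repaired

/-!
# `Balaban1983to89.B6Ineq261LevelGap` — [Balaban1984PropagatorsII] Lemma 2.1 (2.61), the ROW SUM of the multiscale
distance (2.46), PROVED for every contour system with the walk form of (2.2), geometric bond scales and a per-scale
packing bound — in particular for every ℤᵈ nested-cube geometry — with an explicit series constant

T. Bałaban, *Propagators and renormalization transformations for lattice gauge theories. II*, Commun. Math. Phys. **96**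
(1984) 223–250 [Balaban1984PropagatorsII] (cell paper B6; PDF held `paper:balaban1984-cmp96-propagators-rt-ii`, journal page
= PDF page + 222; p. 234 = PDF 12, text layer `p0012.txt` read by this seat: *«Lemma 2.1. For the numbers α, 0 < α < 1, c₁(α) =
12c₀(½α), and RM satisfying (2.59) … sup_{y∈𝔅} Σ_{y′∈𝔅} e^{−αδ₀d(y,y′)} ≤ c₁(α), (2.61)»*; p. 224 [2] (2.2) *«(L^jη)^{−1}
dist(Ω_j^c, Ω_{j+1}) > RM, M is a size of big blocks and R is a big positive integer»*; p. 231 [9] (2.46) and *«a part of Γ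
contained in B^j(Λ_j) consists of bonds of the lattice Λ_j»*; p. 233 [11] (2.57)–(2.59), *«Now we require that RM is
sufficiently large, i.e. we assume ¼αδ₀RM > 2d log c₀(½α) + 1. (2.59)»*).

statement-level skeleton of published theorems with citation tags; proofs where landed; nothing here is a claim about the Yang–Mills mass gap

CITATION HEADER / WHAT IS REPRODUCED.  Mega-formalization `lit-balaban`, HOME `run/shared/lean/pub/lit-balaban/`; Phase-2 proof seat
p29 gen 10 (unit `lit-balaban-p29`, free-target protocol G.5-34(d)).  SKELETON row **B6.Lem2.1** (owner r03; `lit-balaban-r03/ROWS-B6.md`: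
head *«refuted-as-printed (+proved repaired ON TOWERS)»*: the printed constant `c₁(α) = 12c₀(½α)^d` is refuted as typed
(`B6Lemma21Counterexample`, `B6Lemma21TwoDim*`), the repaired Lemma 2.1′/2.1″ (`B6Lemma21Repaired`, `B6Lemma21TwoScale`,
constants `13c₀(½α)^{3d}` / `13c₀(½α)^{4d}`) is PROVED on the level towers (`B6TowerDecomp`, `B6TowerSums.twGeo_ineq261With`) and
on one-scale tori (`B6Lemma21OneScaleTorus`, `B6Lemma21TowerTorus`); off the towers the row-sum bound (2.61″) is carried as *«the
ONLY analytic leaf»* (`B6Lemma21TwoScale.lemma21TwoScale_of_ineq261T`, hypothesis `h261T`)).  DEPGRAPH §2f.1 ranks B6.Lem2.1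
second among the unproved rows that proved rows rest on (19 proved direct dependants): every (190)-knit of [IV]/[III]/[16]
(`B15*From190*`, `B14*From190*`, `B16Ineq123From190`, `B16Ineq147FirstFrom190`, `B16Ineq147Count261`, …) carries `hrow :
B11SectG.RowSum g σ c`, i.e. (2.61) at some rate, for the geometry `g` it is stated on.

THE THEOREM OF THIS FILE (a GENERAL (2.61) with an explicit, L-DEPENDENT constant).  Let `g : B6.Geometry` be REALISED by a
contour system `C` (`B6Geometry.Realizes g C`: `g.dist` = the number of admissible bonds (2.46); `C.ι` injective; admissible
contours exist, `C.bond.Connected`) such that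
* (walk form of (2.2)) `B6Geometry.LevelGap C.bond C.zone N`, `N ≥ 1` — *«every chain of admissible bonds from a point of zone
  < i to a point of zone > i has more than N bonds»* (N = RM; for the ℤᵈ nested-cube systems of `B15Ineq147LevelGap` this is
  `levelGap_cube`, from one layer of `ML^{n+1}`-cubes between `Z″_n` and `(Z″_{n+1})ᶜ`);
* (bond scales) `B6LevelGapMetric.BondScale C.bond C.zone pos ℓ` for a position map `pos : C.Pt → X` into a (pseudo)metric
  space and scales `ℓ` with `0 < ℓ n ≤ ℓ (n+1) ≤ L·ℓ n` — *«a part of Γ contained in B^j(Λ_j) consists of bonds of the lattice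
  Λ_j»* (spacing `L^jη`): an admissible bond joins points at (pseudo)distance `≤ ℓ(min zone)`;
* (per-scale packing) every finite set of zone-`j` points whose positions lie in a ball of radius `R` has at most
  `(2R/ℓ(j) + A)^{dd}` elements — the lattice structure of `Λ_j` (for the cube systems, `pack_cube`: the corners of the
  scale-`j` cubes run over the grid `M₁L^j·ℤᵈ`, `A = 1`, `dd = d`, sup metric).
THEN for every rate `σ ≥ 0` and every `y ∈ 𝔅`: `Σ_{y′∈𝔅} e^{−σd(y,y′)} ≤ K`, for every `K` bounding the partial sums of the series
`Σ_r e^{−σr}·F(r)`, `F(r) = (2(r/N + 1) + 1)·(2r·L^{2(r/N+1)} + A)^{dd}` (integer division) — in particular `K = K261 N dd L A σ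
:= Σ'_r e^{−σr}F(r)`, which is FINITE (the series is summable) as soon as `e^{−σ}·L^{2dd/N} < 1`, i.e. `σ·N > 2·dd·log L`: the
shape of the printed (2.59) *«¼αδ₀RM > 2d log c₀(½α) + 1»* («RM sufficiently large» at fixed rate), with `L` in place of print's
`c₀`.  MECHANISM (ours; the printed route (2.47)–(2.58) through the surface decomposition is the one audited in
`B6Lemma21Bridge`/`B6Lemma21TwoScale` and is NOT used here): by `levelGap_dist` a point at graph distance `≤ r` from `y` has
`|zone − zone y| ≤ r/N + 1` (`zone_window`); along a shortest contour every bond then has (pseudo)length `≤ ℓ(zone y + r/N + 1)`, so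
the endpoint lies within `r·ℓ(zone y + r/N + 1)` of `pos y` (`disp_le_of_dist_le`); by packing and `ℓ(zone y + r/N + 1)/ℓ(j′) ≤
L^{2(r/N+1)}` on the zone window, at most `F(r)` points of `𝔅` lie within graph distance `r` (`card_le_F261_of_dist_le`); summing
the shells against `e^{−σr}` gives the bound (`sum_exp_dist_le`).
HONEST SCOPE (declared, not a GAPS claim).  (i) The constant depends on `L` (through the Euclidean packing count — e.g. `F(1) ≥
(2L²)^{dd}`), whereas print states *«c₁(α) … c₀ is an absolute constant»* (p. 234: constants depending on `d` and `α` only); the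
`L`-free repaired constants on the towers remain the theorems of the r03/p01/b06 lineage; for the (190)-consumers the value of
the constant is immaterial (it enters their `O(1)`).  (ii) (2.2) enters in its WALK form `LevelGap` (as everywhere in the tree),
the existence of admissible contours as `Connected`, and the lattice structure of the `Λ_j` as the packing hypothesis.  (iii)
Nothing else of Lemma 2.1 is touched: (2.60) is `B6Geometry.ineq260_of_levelGap`, (2.62)/(2.63) follow from (2.61) by
`B6Lemma21Repaired.ineq262With_of_261With`/`ineq263With_of_261With` (given here as corollaries).

WHAT THIS FILE PROVES (kernel-checked, zero `sorry`; two `def`s — the shell count `F261` and the series constant `K261` — and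
theorems; no named fact; axioms standard).
§1 `zone_window` · §2 `disp_walk`, `disp_le_of_dist_le` · §3 `scale_ratio_le`, `card_le_F261_of_dist_le` · §4 `sum_exp_dist_le`
(any finite set of points, constant = any bound of the partial sums) · §5 `F261`, `K261`, `F261_nonneg`, `F261_le_geometric`,
`summable_K261`, `partialSum_le_K261`, `K261_nonneg` · §6 for REALISED geometries: **`rowSum_of_realizes`** (`B11SectG.RowSum g σ K`),
**`ineq261With_of_realizes`** (`B6Lemma21Repaired.Ineq261With K g δ₀ α`), `ineq262With_of_realizes`, `ineq263With_of_realizes`,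
and with the series constant **`rowSum_K261_of_realizes`** · §7 THE ℤᵈ NESTED-CUBE SYSTEMS of `B15Ineq147LevelGap` (`CubeSite M₁ L Z`,
`bondC`, `zoneC`, `posC`, `scaleC`): `pack_cube`, `scaleC_succ_le`, `scaleC_mono`, `scaleC_pos`, and **`rowSum_cube`** — (2.61) for
every `B6.Geometry` whose distance is the contour distance of such a system (nested `Z″_n ⊂ ℤᵈ` separated by one layer of
`ML^{n+1}`-cubes, `L ≥ 2`, `M₁ ∣ M`), with `N = M/M₁`, under `e^{−σ}·L^{2d/(M/M₁)} < 1`.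
§8 (v1.1, append-only) THE COARSE-SCALE BOND VARIANT: the same chain under the WEAKER bond-scale hypothesis `dist(pos u, pos v) ≤
ℓ(max(zone u, zone v))` for adjacent `u, v` (an admissible bond across an interface may be read at the COARSER of its two scales —
e.g. two TOUCHING cubes of consecutive scales represented by their corners; `BondScale` (finer scale) implies it for monotone `ℓ`):
`disp_walk_max`, `disp_le_of_dist_le_max`, `card_le_F261_of_dist_le_max`, `sum_exp_dist_le_max`, **`rowSum_of_realizes_max`**,
`rowSum_K261_of_realizes_max`, and **`rowSum_cubeSites`** — (2.61) for a geometry realised by ANY bond graph on the cube-sites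
`CubeSite M₁ L Z` whose bonds join cubes with corners within the coarser scale (touching cubes qualify), given its `LevelGap N` and
connectedness (packing by `pack_cube`).
§9 (v1.1) THE CONSTANT IN CLOSED FORM: **`K261_le_closedForm`** — `K261 N dd L A σ ≤ 3(A+2)^{dd}L^{2dd}·(dd+1)!/(1 − θ)^{dd+2}`,
`θ = e^{−σ}L^{2dd/N} < 1` (from `F261_le_geometric`, `(r+1)^{dd+1} ≤ (dd+1)!·C(r+dd+1, dd+1)` and the negative-binomial series).
§10 (v1.2, append-only) LEMMA 2.1 AS A WHOLE — ALL FOUR DISPLAYS (2.60) ∧ (2.61) ∧ (2.62) ∧ (2.63) (`B6RandomWalk.Ineq260`,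
`B6Lemma21Repaired.Ineq261With/Ineq262With/Ineq263With`, constant `K261 N dd L A (αδ₀)`, rate `αδ₀`, `δ₀ ≥ 0`, `0 ≤ α ≤ 1`,
under `e^{−αδ₀}·L^{2dd/N} < 1`): **`lemma21_of_realizes`** (realised contour system, `LevelGap N`, `RM ≤ N`, bond scales, packing;
(2.60) by `B6Geometry.ineq260_of_levelGap`), `lemma21_of_realizes_max` (coarse-scale bonds; with `ineq261With_of_realizes_max`),
**`lemma21_of_cond22`** — the geometric inputs in PRINTED shape: bond lengths `L^jη` (`B6LevelGapMetric.BondScale22`) and (2.2)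
on lattice points (`B6LevelGapMetric.Cond22`) with `RM = N ∈ ℕ`, the walk form supplied by `B6LevelGapMetric.levelGap_of_cond22` —,
the FAMILY forms with an `i`-independent constant `lemma21_family_of_realizes`, `lemma21_family_of_cond22` (the shape of
`B6Lemma21Repaired.Lemma21Repaired` / `B6LevelGapMetric.lemma21Printed_of_ineq261_cond22`, (2.61) now proved instead of assumed,
condition `e^{−αδ₀}L^{2dd/N} < 1` in place of (2.59)), the cube-model instances `lemma21_cubeSites`, `lemma21_cube`, and the
logarithmic form of the condition `theta_lt_one_of_log` (`2dd·log L < σN ⇒ e^{−σ}L^{2dd/N} < 1`).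
§11 (v1.3, append-only) MONOTONICITY — ONE CONSTANT FOR A WHOLE FAMILY: `levelGap_of_le` (the walk form `LevelGap` is antitone in
`N`), `F261_anti_N`, `K261_anti_N`, `K261_anti_sigma` (the constant decreases as the level gap or the rate grows), `theta_mono` (so does
the summability parameter), and **`rowSum_K261_uniform`**: a realised system with `LevelGap N′`, `N′ ≥ N`, at any rate `σ′ ≥ σ` has
`RowSum g σ′ (K261 N dd L A σ)` under the condition at `(σ, N)` — print's single `c₁(α)` serving all members (`R_kM_k ≥ N`) and
all rates `αδ₀ ≥ σ`.
-/

namespace Literature.MathematicalPhysics.QuantumFieldTheory.Balaban1983to89.B6Ineq261LevelGap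

open Literature.MathematicalPhysics.QuantumFieldTheory.Balaban1983to89
open B6Geometry B6LevelGapMetric B11SectG Finset

noncomputable section

/-! ## §1. The zone window of a graph ball (from the level-gap bound) -/

section Graph

variable {V X : Type*} [PseudoMetricSpace X] {G : SimpleGraph V} {zone : V → ℕ} {pos : V → X} {ℓ : ℕ → ℝ} {N : ℕ}

/-- **Zone window.**  Under the walk form of (2.2) (`LevelGap N`, `N ≥ 1`), a point at graph distance `≤ r` from `y` has its zone
within `r/N + 1` of the zone of `y` (integer division) — from `B6Geometry.levelGap_dist` *"N·(|zone x − zone x′| − 1) ≤ d(x, x′)"*,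
the content of (2.60). [cite: Balaban1984PropagatorsII, (2.2) p.224, (2.57) p.233, (2.60) p.234] -/
theorem zone_window (hconn : G.Connected) (hgap : LevelGap G zone N) (hN : 0 < N) {y w : V} {r : ℕ}
    (h : G.dist y w ≤ r) : zone w ≤ zone y + (r / N + 1) ∧ zone y ≤ zone w + (r / N + 1) := by
  have key : ∀ {a b : V}, zone a < zone b → G.dist a b ≤ r → zone b - zone a - 1 ≤ r / N := by
    intro a b hlt hd
    have h1 := levelGap_dist hconn hgap hlt
    rw [Nat.le_div_iff_mul_le hN]
    calc (zone b - zone a - 1) * N = N * (zone b - zone a - 1) := by ring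
      _ ≤ G.dist a b := h1
      _ ≤ r := hd
  have hw : zone y < zone w → zone w - zone y - 1 ≤ r / N := fun hlt => key hlt h
  have hy : zone w < zone y → zone y - zone w - 1 ≤ r / N := fun hlt =>
    key hlt (by rwa [SimpleGraph.dist_comm])
  generalize r / N = q at hw hy ⊢
  constructor
  · by_cases hlt : zone y < zone w
    · have := hw hlt; omega
    · omega
  · by_cases hlt : zone w < zone y
    · have := hy hlt; omega
    · omega

/-! ## §2. Displacement along admissible contours (bond scales) -/

/-- **Displacement along a contour inside the ball.**  With bond scales `ℓ` (monotone) and the zone window, every admissible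
contour `p` from `u` to `v` with `d(y, u) + |p| ≤ r` satisfies `dist(pos u, pos v) ≤ |p|·ℓ(zone y + r/N + 1)` — each of its
bonds joins points of zone `≤ zone y + r/N + 1`, hence has (pseudo)length `≤ ℓ(zone y + r/N + 1)` (*"a part of Γ contained in
B^j(Λ_j) consists of bonds of the lattice Λ_j"*, (2.48)). [cite: Balaban1984PropagatorsII, (2.46)–(2.48) pp.231–232] -/
theorem disp_walk (hconn : G.Connected) (hgap : LevelGap G zone N) (hN : 0 < N) (hbond : BondScale G zone pos ℓ)
    (hmono : Monotone ℓ) (y : V) (r : ℕ) :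
    ∀ {u v : V} (p : G.Walk u v), G.dist y u + p.length ≤ r →
      dist (pos u) (pos v) ≤ p.length * ℓ (zone y + (r / N + 1)) := by
  intro u v p
  induction p with
  | nil => intro _; simp
  | @cons u w v hadj q ih =>
    intro hlen
    rw [SimpleGraph.Walk.length_cons] at hlen
    have hdu : G.dist y u ≤ r := by omega
    have h1 : G.dist u w ≤ 1 := by
      have := SimpleGraph.dist_le hadj.toWalk
      simpa using this
    have hdw : G.dist y w ≤ G.dist y u + 1 :=
      (hconn.dist_triangle (u := y) (v := u) (w := w)).trans (by omega)
    have ih' := ih (by omega)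
    have hzu : zone u ≤ zone y + (r / N + 1) := (zone_window hconn hgap hN hdu).1
    have hstep : dist (pos u) (pos w) ≤ ℓ (zone y + (r / N + 1)) :=
      (hbond hadj).trans (hmono ((min_le_left _ _).trans hzu))
    calc dist (pos u) (pos v) ≤ dist (pos u) (pos w) + dist (pos w) (pos v) := dist_triangle _ _ _
      _ ≤ ℓ (zone y + (r / N + 1)) + q.length * ℓ (zone y + (r / N + 1)) := add_le_add hstep ih'
      _ = (SimpleGraph.Walk.cons hadj q).length * ℓ (zone y + (r / N + 1)) := by
          rw [SimpleGraph.Walk.length_cons]; push_cast; ring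

/-- **Displacement bound of a graph ball**: `d(y, v) ≤ r ⇒ dist(pos y, pos v) ≤ r·ℓ(zone y + r/N + 1)` (a shortest admissible
contour exists: `Connected`). [cite: Balaban1984PropagatorsII, (2.46)–(2.48) pp.231–232] -/
theorem disp_le_of_dist_le (hconn : G.Connected) (hgap : LevelGap G zone N) (hN : 0 < N) (hbond : BondScale G zone pos ℓ)
    (hmono : Monotone ℓ) (hℓ0 : ∀ n, 0 ≤ ℓ n) {y v : V} {r : ℕ} (h : G.dist y v ≤ r) :
    dist (pos y) (pos v) ≤ r * ℓ (zone y + (r / N + 1)) := by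
  obtain ⟨p, hp⟩ := hconn.exists_walk_length_eq_dist y v
  have h1 := disp_walk hconn hgap hN hbond hmono y r p (by rw [SimpleGraph.dist_self, hp]; omega)
  rw [hp] at h1
  exact h1.trans (mul_le_mul_of_nonneg_right (by exact_mod_cast h) (hℓ0 _))

/-! ## §3. The count of a graph ball (packing) -/

/-- Geometric scales (the spacings `L^jη` of the lattices `Λ_j`): `ℓ(n+1) ≤ L·ℓ(n)` for all `n`, `L ≥ 1` ⇒ `ℓ(b + k) ≤ L^k·ℓ(b)`.
[cite: Balaban1984PropagatorsII, (2.1)–(2.2) p.224] -/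
theorem scale_ratio_le {Lr : ℝ} (hℓL : ∀ n, ℓ (n + 1) ≤ Lr * ℓ n) (hLr : 1 ≤ Lr) (b k : ℕ) :
    ℓ (b + k) ≤ Lr ^ k * ℓ b := by
  induction k with
  | zero => simp
  | succ k ih =>
    calc ℓ (b + (k + 1)) = ℓ (b + k + 1) := by rw [Nat.add_assoc]
      _ ≤ Lr * ℓ (b + k) := hℓL _
      _ ≤ Lr * (Lr ^ k * ℓ b) := mul_le_mul_of_nonneg_left ih (by linarith)
      _ = Lr ^ (k + 1) * ℓ b := by ring

/-- **The shell count `F(r)`** of the series constant: `(2(r/N + 1) + 1)·(2r·L^{2(r/N+1)} + A)^{dd}` — the number of zones in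
the zone window times the packing count of one zone in the displacement ball. [cite: Balaban1984PropagatorsII, (2.58)–(2.59) p.233] -/
def F261 (N dd : ℕ) (Lr A : ℝ) (r : ℕ) : ℝ :=
  (2 * ((r / N + 1 : ℕ) : ℝ) + 1) * (2 * (r : ℝ) * Lr ^ (2 * (r / N + 1)) + A) ^ dd

/-- `F(r) ≥ 0` (`A ≥ 0`, `L ≥ 0`) — sign of the shell count of the (2.61) constant. [cite: Balaban1984PropagatorsII, Lemma 2.1 (2.61) p.234] -/
theorem F261_nonneg {N dd : ℕ} {Lr A : ℝ} (hLr : 0 ≤ Lr) (hA : 0 ≤ A) (r : ℕ) : 0 ≤ F261 N dd Lr A r := by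
  unfold F261; positivity

/-- **At most `F(r)` points of `𝔅` within graph distance `r`** (packing).  For a finite set `S` of points all at graph distance `≤ r`
from `y`: `|S| ≤ F(r)` — every point of `S` has zone `j′` in the window `[zone y − (r/N+1), zone y + (r/N+1)]` (§1) and position
within `r·ℓ(zone y + r/N + 1)` of `pos y` (§2); per zone the packing bound gives `≤ (2r·ℓ(zone y + r/N + 1)/ℓ(j′) + A)^{dd} ≤
(2r·L^{2(r/N+1)} + A)^{dd}` points, and there are `≤ 2(r/N+1) + 1` zones. [cite: Balaban1984PropagatorsII, (2.58) p.233, (2.61) p.234] -/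
theorem card_le_F261_of_dist_le {dd : ℕ} {Lr A : ℝ} (hconn : G.Connected) (hgap : LevelGap G zone N) (hN : 0 < N)
    (hbond : BondScale G zone pos ℓ) (hmono : Monotone ℓ) (hℓpos : ∀ n, 0 < ℓ n) (hℓL : ∀ n, ℓ (n + 1) ≤ Lr * ℓ n)
    (hLr : 1 ≤ Lr) (hA : 0 ≤ A)
    (hpack : ∀ (j : ℕ) (p : X) (R : ℝ) (S : Finset V), 0 ≤ R → (∀ v ∈ S, zone v = j ∧ dist (pos v) p ≤ R) →
      (#S : ℝ) ≤ (2 * R / ℓ j + A) ^ dd)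
    (y : V) (r : ℕ) (S : Finset V) (hS : ∀ v ∈ S, G.dist y v ≤ r) :
    (#S : ℝ) ≤ F261 N dd Lr A r := by
  classical
  have hℓ0 : ∀ n, 0 ≤ ℓ n := fun n => (hℓpos n).le
  set m : ℕ := r / N + 1 with hm
  set Z : ℕ := zone y + m with hZ
  set Rad : ℝ := (r : ℝ) * ℓ Z with hRad
  have hRad0 : 0 ≤ Rad := mul_nonneg (Nat.cast_nonneg r) (hℓ0 Z)
  -- every point of S has its zone in the window and its position in the ball
  have hwin : ∀ v ∈ S, zone v ∈ Icc (zone y - m) Z := fun v hv => by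
    have := zone_window hconn hgap hN (hS v hv)
    rw [mem_Icc]; constructor <;> omega
  have hball : ∀ v ∈ S, dist (pos v) (pos y) ≤ Rad := fun v hv => by
    rw [dist_comm]; exact disp_le_of_dist_le hconn hgap hN hbond hmono hℓ0 (hS v hv)
  -- per-zone count
  have hzone : ∀ j' ∈ Icc (zone y - m) Z,
      (#{v ∈ S | zone v = j'} : ℝ) ≤ (2 * (r : ℝ) * Lr ^ (2 * m) + A) ^ dd := by
    intro j' hj'
    rw [mem_Icc] at hj'
    have h1 := hpack j' (pos y) Rad {v ∈ S | zone v = j'} hRad0 (fun v hv => by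
      rw [mem_filter] at hv
      exact ⟨hv.2, hball v hv.1⟩)
    have hnn : 0 ≤ 2 * Rad / ℓ j' + A := add_nonneg (div_nonneg (mul_nonneg (by norm_num) hRad0) (hℓ0 j')) hA
    refine h1.trans (pow_le_pow_left₀ hnn ?_ dd)
    -- 2·Rad/ℓ(j′) ≤ 2r·L^{2m}: ℓ(Z) ≤ L^{Z − j′}·ℓ(j′) ≤ L^{2m}·ℓ(j′)
    have hZj : Z - j' ≤ 2 * m := by omega
    have hratio : ℓ Z ≤ Lr ^ (2 * m) * ℓ j' := by
      have e : Z = j' + (Z - j') := by omega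
      calc ℓ Z = ℓ (j' + (Z - j')) := by rw [← e]
        _ ≤ Lr ^ (Z - j') * ℓ j' := scale_ratio_le hℓL hLr j' (Z - j')
        _ ≤ Lr ^ (2 * m) * ℓ j' := mul_le_mul_of_nonneg_right (pow_le_pow_right₀ hLr hZj) (hℓ0 j')
    have hkey : 2 * Rad / ℓ j' ≤ 2 * (r : ℝ) * Lr ^ (2 * m) := by
      rw [div_le_iff₀ (hℓpos j'), hRad]
      have hr0 : (0 : ℝ) ≤ 2 * (r : ℝ) := by positivity
      calc 2 * ((r : ℝ) * ℓ Z) = 2 * (r : ℝ) * ℓ Z := by ring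
        _ ≤ 2 * (r : ℝ) * (Lr ^ (2 * m) * ℓ j') := mul_le_mul_of_nonneg_left hratio hr0
        _ = 2 * (r : ℝ) * Lr ^ (2 * m) * ℓ j' := by ring
    linarith
  -- sum over the zones of the window
  have hcard : (#S : ℝ) = ∑ j' ∈ Icc (zone y - m) Z, (#{v ∈ S | zone v = j'} : ℝ) := by
    have := Finset.card_eq_sum_card_fiberwise (f := zone) (s := S) (t := Icc (zone y - m) Z) hwin
    rw [this]; push_cast; rfl
  have hIcc : (#(Icc (zone y - m) Z) : ℝ) ≤ 2 * (m : ℝ) + 1 := by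
    rw [Nat.card_Icc]
    have : Z + 1 - (zone y - m) ≤ 2 * m + 1 := by omega
    exact_mod_cast this
  calc (#S : ℝ) = ∑ j' ∈ Icc (zone y - m) Z, (#{v ∈ S | zone v = j'} : ℝ) := hcard
    _ ≤ ∑ j' ∈ Icc (zone y - m) Z, (2 * (r : ℝ) * Lr ^ (2 * m) + A) ^ dd := sum_le_sum hzone
    _ = (#(Icc (zone y - m) Z) : ℝ) * (2 * (r : ℝ) * Lr ^ (2 * m) + A) ^ dd := by rw [sum_const, nsmul_eq_mul]
    _ ≤ (2 * (m : ℝ) + 1) * (2 * (r : ℝ) * Lr ^ (2 * m) + A) ^ dd :=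
        mul_le_mul_of_nonneg_right hIcc (by positivity)
    _ = F261 N dd Lr A r := by simp only [F261, hm]

/-! ## §4. The row sum over any finite set of points -/

/-- **(2.61) over a finite set of points, constant = any bound of the partial sums.**  With the hypotheses of §3 and `σ ≥ 0`:
`Σ_{v∈S} e^{−σd(y,v)} ≤ K` whenever `Σ_{r=0}^{R} e^{−σr}F(r) ≤ K` for all `R` — sum the shells `{d(y, ·) = r}` (each of
cardinality `≤ F(r)`, §3) against `e^{−σr}`. [cite: Balaban1984PropagatorsII, Lemma 2.1 (2.61) p.234] -/
theorem sum_exp_dist_le {dd : ℕ} {Lr A σ K : ℝ} (hconn : G.Connected) (hgap : LevelGap G zone N) (hN : 0 < N)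
    (hbond : BondScale G zone pos ℓ) (hmono : Monotone ℓ) (hℓpos : ∀ n, 0 < ℓ n) (hℓL : ∀ n, ℓ (n + 1) ≤ Lr * ℓ n)
    (hLr : 1 ≤ Lr) (hA : 0 ≤ A)
    (hpack : ∀ (j : ℕ) (p : X) (R : ℝ) (S : Finset V), 0 ≤ R → (∀ v ∈ S, zone v = j ∧ dist (pos v) p ≤ R) →
      (#S : ℝ) ≤ (2 * R / ℓ j + A) ^ dd)
    (hK : ∀ R : ℕ, ∑ r ∈ range (R + 1), Real.exp (-(σ * r)) * F261 N dd Lr A r ≤ K)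
    (y : V) (S : Finset V) :
    ∑ v ∈ S, Real.exp (-(σ * G.dist y v)) ≤ K := by
  classical
  -- the shells `{v ∈ S | d(y,v) = r}`, `r ≤ D := max_S d(y,·)`
  set D : ℕ := S.sup (fun v => G.dist y v) with hD
  have hmaps : ∀ v ∈ S, G.dist y v ∈ range (D + 1) := fun v hv =>
    mem_range.mpr (Nat.lt_succ_of_le (Finset.le_sup (f := fun v => G.dist y v) hv))
  rw [← Finset.sum_fiberwise_of_maps_to hmaps]
  refine le_trans (sum_le_sum fun r _ => ?_) (hK D)
  -- shell r: Σ_{v ∈ S, d = r} e^{−σ d} = #shell · e^{−σ r} ≤ F(r)·e^{−σ r}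
  have hshell : ∑ v ∈ S with G.dist y v = r, Real.exp (-(σ * G.dist y v)) =
      (#{v ∈ S | G.dist y v = r} : ℝ) * Real.exp (-(σ * r)) := by
    rw [Finset.card_eq_sum_ones, Nat.cast_sum, Finset.sum_mul]
    refine Finset.sum_congr rfl fun v hv => ?_
    rw [(Finset.mem_filter.mp hv).2]
    simp
  rw [hshell, mul_comm]
  refine mul_le_mul_of_nonneg_left ?_ (Real.exp_pos _).le
  exact card_le_F261_of_dist_le hconn hgap hN hbond hmono hℓpos hℓL hLr hA hpack y r _
    (fun v hv => ((mem_filter.mp hv).2).le)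

end Graph

/-! ## §5. The series constant and its finiteness under the (2.59)-shape condition -/

section Constant

/-- **The series constant** `K = Σ'_{r≥0} e^{−σr}·F(r)` of this file's (2.61) (value `0` by convention if the series diverges;
finite = the actual sum under `e^{−σ}·L^{2dd/N} < 1`, `summable_K261`). [cite: Balaban1984PropagatorsII, Lemma 2.1 (2.61) p.234, (2.59) p.233] -/
def K261 (N dd : ℕ) (Lr A σ : ℝ) : ℝ :=
  ∑' r : ℕ, Real.exp (-(σ * r)) * F261 N dd Lr A r

/-- **Geometric majorant of the shell terms**: `e^{−σr}F(r) ≤ 3(A+2)^{dd}L^{2dd} · (r+1)^{dd+1} · θ^r`, `θ = e^{−σ}·L^{2dd/N}`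
(`L ≥ 1`, `A ≥ 0`, `N ≥ 1`). [cite: Balaban1984PropagatorsII, (2.59) p.233] -/
theorem F261_le_geometric {N dd : ℕ} {Lr A σ : ℝ} (hN : 0 < N) (hLr : 1 ≤ Lr) (hA : 0 ≤ A) (r : ℕ) :
    Real.exp (-(σ * r)) * F261 N dd Lr A r ≤
      (3 * (A + 2) ^ dd * Lr ^ (2 * dd)) * (((r : ℝ) + 1) ^ (dd + 1) *
        (Real.exp (-σ) * Lr ^ ((2 * dd : ℝ) / N)) ^ r) := by
  have hLr0 : 0 < Lr := by linarith
  set m : ℕ := r / N + 1 with hm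
  -- (a) the zone factor
  have ha : 2 * ((m : ℕ) : ℝ) + 1 ≤ 3 * ((r : ℝ) + 1) := by
    have : (m : ℝ) ≤ (r : ℝ) + 1 := by
      have h1 : r / N ≤ r := Nat.div_le_self r N
      have : (m : ℝ) = ((r / N : ℕ) : ℝ) + 1 := by simp [hm]
      rw [this]
      have : ((r / N : ℕ) : ℝ) ≤ r := by exact_mod_cast h1
      linarith
    linarith
  -- (b) the packing factor: 2r·L^{2m} + A ≤ (A+2)(r+1)·L^{2m}
  have hL2m : 1 ≤ Lr ^ (2 * m) := one_le_pow₀ hLr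
  have hb : 2 * (r : ℝ) * Lr ^ (2 * m) + A ≤ (A + 2) * ((r : ℝ) + 1) * Lr ^ (2 * m) := by
    have hr0 : (0 : ℝ) ≤ r := Nat.cast_nonneg r
    have hX1 : A ≤ A * Lr ^ (2 * m) := le_mul_of_one_le_right hA hL2m
    have hX2 : 0 ≤ A * (r : ℝ) * Lr ^ (2 * m) + 2 * Lr ^ (2 * m) := by positivity
    nlinarith [hX1, hX2]
  have hb' : (2 * (r : ℝ) * Lr ^ (2 * m) + A) ^ dd ≤ ((A + 2) * ((r : ℝ) + 1) * Lr ^ (2 * m)) ^ dd :=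
    pow_le_pow_left₀ (by positivity) hb dd
  -- (c) L^{2m·dd} ≤ L^{2dd}·(L^{2dd/N})^r
  have hc : (Lr ^ (2 * m)) ^ dd ≤ Lr ^ (2 * dd) * (Lr ^ ((2 * dd : ℝ) / N)) ^ r := by
    have hNr : (0 : ℝ) < N := by exact_mod_cast hN
    have e1 : (Lr ^ (2 * m)) ^ dd = Lr ^ (2 * dd) * Lr ^ (2 * dd * (r / N)) := by
      rw [← pow_mul, hm]; ring_nf
    rw [e1]
    refine mul_le_mul_of_nonneg_left ?_ (by positivity)
    -- ℕ-power ≤ real power: 2dd·(r/N) ≤ (2dd/N)·r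
    have h2 : (Lr ^ ((2 * dd : ℝ) / N)) ^ r = Lr ^ ((2 * dd : ℝ) / N * r) := by
      rw [← Real.rpow_natCast, ← Real.rpow_mul hLr0.le]
    rw [h2, ← Real.rpow_natCast]
    refine Real.rpow_le_rpow_of_exponent_le hLr ?_
    have h3 : ((r / N : ℕ) : ℝ) ≤ (r : ℝ) / N := Nat.cast_div_le
    push_cast
    calc (2 : ℝ) * dd * ((r / N : ℕ) : ℝ) ≤ 2 * dd * ((r : ℝ) / N) :=
          mul_le_mul_of_nonneg_left h3 (by positivity)
      _ = 2 * dd / N * r := by ring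
  -- assemble
  have hexp : Real.exp (-(σ * r)) = Real.exp (-σ) ^ r := by
    rw [← Real.exp_nat_mul]; ring_nf
  unfold F261
  rw [← hm, hexp]
  have hE : 0 ≤ Real.exp (-σ) ^ r := pow_nonneg (Real.exp_pos _).le r
  calc Real.exp (-σ) ^ r * ((2 * ((m : ℕ) : ℝ) + 1) * (2 * (r : ℝ) * Lr ^ (2 * m) + A) ^ dd)
      ≤ Real.exp (-σ) ^ r * ((3 * ((r : ℝ) + 1)) * ((A + 2) * ((r : ℝ) + 1) * Lr ^ (2 * m)) ^ dd) :=
        mul_le_mul_of_nonneg_left (mul_le_mul ha hb' (by positivity) (by positivity)) hE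
    _ = Real.exp (-σ) ^ r * (3 * (A + 2) ^ dd * ((r : ℝ) + 1) ^ (dd + 1) * (Lr ^ (2 * m)) ^ dd) := by
        rw [mul_pow, mul_pow, pow_succ]; ring
    _ ≤ Real.exp (-σ) ^ r * (3 * (A + 2) ^ dd * ((r : ℝ) + 1) ^ (dd + 1) *
          (Lr ^ (2 * dd) * (Lr ^ ((2 * dd : ℝ) / N)) ^ r)) :=
        mul_le_mul_of_nonneg_left (mul_le_mul_of_nonneg_left hc (by positivity)) hE
    _ = (3 * (A + 2) ^ dd * Lr ^ (2 * dd)) * (((r : ℝ) + 1) ^ (dd + 1) *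
          (Real.exp (-σ) * Lr ^ ((2 * dd : ℝ) / N)) ^ r) := by rw [mul_pow]; ring

/-- **Finiteness of the constant under the (2.59)-shape condition** `θ = e^{−σ}·L^{2dd/N} < 1` (i.e. `σN > 2dd·log L` —
*«we require that RM is sufficiently large»*): the series `Σ_r e^{−σr}F(r)` is summable. [cite: Balaban1984PropagatorsII, (2.59) p.233, Lemma 2.1 p.234] -/
theorem summable_K261 {N dd : ℕ} {Lr A σ : ℝ} (hN : 0 < N) (hLr : 1 ≤ Lr) (hA : 0 ≤ A)
    (hθ : Real.exp (-σ) * Lr ^ ((2 * dd : ℝ) / N) < 1) :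
    Summable (fun r : ℕ => Real.exp (-(σ * r)) * F261 N dd Lr A r) := by
  set θ : ℝ := Real.exp (-σ) * Lr ^ ((2 * dd : ℝ) / N) with hθdef
  have hθ0 : 0 ≤ θ := by positivity
  have hθn : ‖θ‖ < 1 := by rw [Real.norm_eq_abs, abs_of_nonneg hθ0]; exact hθ
  -- (r+1)^{dd+1} θ^r ≤ 2^{dd+1} (r^{dd+1} θ^r + θ^r)
  have hmaj : Summable (fun r : ℕ => ((r : ℝ) + 1) ^ (dd + 1) * θ ^ r) := by
    have h1 : Summable (fun r : ℕ => ((r : ℝ) ^ (dd + 1) : ℝ) * θ ^ r) :=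
      summable_pow_mul_geometric_of_norm_lt_one (dd + 1) hθn
    have h2 : Summable (fun r : ℕ => θ ^ r) := summable_geometric_of_lt_one hθ0 hθ
    have h3 : Summable (fun r : ℕ => (2 : ℝ) ^ (dd + 1) * (((r : ℝ) ^ (dd + 1)) * θ ^ r + θ ^ r)) :=
      (h1.add h2).mul_left _
    refine Summable.of_nonneg_of_le (fun r => by positivity) (fun r => ?_) h3
    have hr1 : ((r : ℝ) + 1) ^ (dd + 1) ≤ (2 : ℝ) ^ (dd + 1) * ((r : ℝ) ^ (dd + 1) + 1) := by
      rcases Nat.eq_zero_or_pos r with h0 | hpos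
      · subst h0
        have h2k : (1 : ℝ) ≤ 2 ^ (dd + 1) := one_le_pow₀ (by norm_num)
        have e1 : (((0 : ℕ) : ℝ) + 1) ^ (dd + 1) = 1 := by simp
        have e2 : ((0 : ℕ) : ℝ) ^ (dd + 1) + 1 = 1 := by simp
        rw [e1, e2, mul_one]
        exact h2k
      · have hr : (1 : ℝ) ≤ r := by exact_mod_cast hpos
        calc ((r : ℝ) + 1) ^ (dd + 1) ≤ (2 * (r : ℝ)) ^ (dd + 1) :=
              pow_le_pow_left₀ (by positivity) (by linarith) _
          _ = (2 : ℝ) ^ (dd + 1) * (r : ℝ) ^ (dd + 1) := by rw [mul_pow]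
          _ ≤ (2 : ℝ) ^ (dd + 1) * ((r : ℝ) ^ (dd + 1) + 1) := by
              refine mul_le_mul_of_nonneg_left (by linarith) (by positivity)
    calc ((r : ℝ) + 1) ^ (dd + 1) * θ ^ r ≤ ((2 : ℝ) ^ (dd + 1) * ((r : ℝ) ^ (dd + 1) + 1)) * θ ^ r :=
          mul_le_mul_of_nonneg_right hr1 (pow_nonneg hθ0 r)
      _ = (2 : ℝ) ^ (dd + 1) * (((r : ℝ) ^ (dd + 1)) * θ ^ r + θ ^ r) := by ring
  refine Summable.of_nonneg_of_le (fun r => mul_nonneg (Real.exp_pos _).le (F261_nonneg (by linarith) hA r))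
    (fun r => F261_le_geometric hN hLr hA r) (hmaj.mul_left _)

/-- The partial sums of the (2.61) series are bounded by the constant `K261` (when the series is summable).
[cite: Balaban1984PropagatorsII, Lemma 2.1 (2.61) p.234] -/
theorem partialSum_le_K261 {N dd : ℕ} {Lr A σ : ℝ} (hLr : 0 ≤ Lr) (hA : 0 ≤ A)
    (hsum : Summable (fun r : ℕ => Real.exp (-(σ * r)) * F261 N dd Lr A r)) (R : ℕ) :
    ∑ r ∈ range (R + 1), Real.exp (-(σ * r)) * F261 N dd Lr A r ≤ K261 N dd Lr A σ :=
  hsum.sum_le_tsum (range (R + 1)) fun r _ => mul_nonneg (Real.exp_pos _).le (F261_nonneg hLr hA r)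

/-- The (2.61) constant is non-negative: `K261 ≥ 0`. [cite: Balaban1984PropagatorsII, Lemma 2.1 (2.61) p.234] -/
theorem K261_nonneg {N dd : ℕ} {Lr A σ : ℝ} (hLr : 0 ≤ Lr) (hA : 0 ≤ A) : 0 ≤ K261 N dd Lr A σ :=
  tsum_nonneg fun r => mul_nonneg (Real.exp_pos _).le (F261_nonneg hLr hA r)

end Constant

/-! ## §6. (2.61) for REALISED geometries -/

section Realised

variable {g : B6.Geometry} {C : ContourSystem g} {X : Type*} [PseudoMetricSpace X] {pos : C.Pt → X} {ℓ : ℕ → ℝ}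
  {N dd : ℕ} {Lr A : ℝ}

/-- **Lemma 2.1 (2.61) — the ROW SUM — for every REALISED contour system with the walk form of (2.2), geometric bond scales and
per-scale packing** (`B11SectG.RowSum g σ K`: `sup_{y∈𝔅} Σ_{y′∈𝔅} e^{−σd(y,y′)} ≤ K`), for every `K` bounding the partial sums of
`Σ_r e^{−σr}F(r)`.  Hypotheses: `Realizes g C` ((2.46)), `C.ι` injective (the points of `𝔅` are points of the bond graph),
`C.bond.Connected` (admissible contours exist), `LevelGap N` (`N ≥ 1`), `BondScale … pos ℓ` with `0 < ℓ n`, `ℓ` monotone,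
`ℓ(n+1) ≤ L·ℓ(n)`, `L ≥ 1`, packing with `A ≥ 0`, `σ ≥ 0`. [cite: Balaban1984PropagatorsII, Lemma 2.1 (2.61) p.234, (2.2) p.224, (2.46) p.231] -/
theorem rowSum_of_realizes {σ K : ℝ} (hreal : Realizes g C) (hι : Function.Injective C.ι) (hconn : C.bond.Connected)
    (hgap : LevelGap C.bond C.zone N) (hN : 0 < N) (hbond : BondScale C.bond C.zone pos ℓ) (hmono : Monotone ℓ)
    (hℓpos : ∀ n, 0 < ℓ n) (hℓL : ∀ n, ℓ (n + 1) ≤ Lr * ℓ n) (hLr : 1 ≤ Lr) (hA : 0 ≤ A)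
    (hpack : ∀ (j : ℕ) (p : X) (R : ℝ) (S : Finset C.Pt), 0 ≤ R → (∀ v ∈ S, C.zone v = j ∧ dist (pos v) p ≤ R) →
      (#S : ℝ) ≤ (2 * R / ℓ j + A) ^ dd)
    (hK : ∀ R : ℕ, ∑ r ∈ range (R + 1), Real.exp (-(σ * r)) * F261 N dd Lr A r ≤ K) :
    RowSum g σ K := by
  classical
  intro y
  have hre : ∀ y', Real.exp (-(σ * g.dist y y')) = Real.exp (-(σ * (C.bond.dist (C.ι y) (C.ι y') : ℕ))) := fun y' => by
    rw [hreal y y']; rfl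
  simp_rw [hre]
  rw [← Finset.sum_image (f := fun v => Real.exp (-(σ * (C.bond.dist (C.ι y) v : ℕ))))
    (fun a _ b _ h => hι h)]
  exact sum_exp_dist_le hconn hgap hN hbond hmono hℓpos hℓL hLr hA hpack hK (C.ι y) _

/-- **(2.61) in the cell's generic-constant shape** `B6Lemma21Repaired.Ineq261With K g δ₀ α` (rate `αδ₀ ≥ 0`), same
hypotheses. [cite: Balaban1984PropagatorsII, Lemma 2.1 (2.61) p.234] -/
theorem ineq261With_of_realizes {δ₀ α K : ℝ} (hreal : Realizes g C) (hι : Function.Injective C.ι)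
    (hconn : C.bond.Connected) (hgap : LevelGap C.bond C.zone N) (hN : 0 < N) (hbond : BondScale C.bond C.zone pos ℓ)
    (hmono : Monotone ℓ) (hℓpos : ∀ n, 0 < ℓ n) (hℓL : ∀ n, ℓ (n + 1) ≤ Lr * ℓ n) (hLr : 1 ≤ Lr) (hA : 0 ≤ A)
    (hpack : ∀ (j : ℕ) (p : X) (R : ℝ) (S : Finset C.Pt), 0 ≤ R → (∀ v ∈ S, C.zone v = j ∧ dist (pos v) p ≤ R) →
      (#S : ℝ) ≤ (2 * R / ℓ j + A) ^ dd)
    (hK : ∀ R : ℕ, ∑ r ∈ range (R + 1), Real.exp (-((α * δ₀) * r)) * F261 N dd Lr A r ≤ K) :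
    B6Lemma21Repaired.Ineq261With K g δ₀ α := by
  intro y
  have h := rowSum_of_realizes hreal hι hconn hgap hN hbond hmono hℓpos hℓL hLr hA hpack hK y
  simpa [mul_assoc] using h

/-- **(2.62) (chain bound) from this (2.61)**, by `B6Lemma21Repaired.ineq262With_of_261With`. [cite: Balaban1984PropagatorsII, (2.62) p.234] -/
theorem ineq262With_of_realizes {δ₀ α K : ℝ} (hreal : Realizes g C) (hι : Function.Injective C.ι)
    (hconn : C.bond.Connected) (hgap : LevelGap C.bond C.zone N) (hN : 0 < N) (hbond : BondScale C.bond C.zone pos ℓ)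
    (hmono : Monotone ℓ) (hℓpos : ∀ n, 0 < ℓ n) (hℓL : ∀ n, ℓ (n + 1) ≤ Lr * ℓ n) (hLr : 1 ≤ Lr) (hA : 0 ≤ A)
    (hpack : ∀ (j : ℕ) (p : X) (R : ℝ) (S : Finset C.Pt), 0 ≤ R → (∀ v ∈ S, C.zone v = j ∧ dist (pos v) p ≤ R) →
      (#S : ℝ) ≤ (2 * R / ℓ j + A) ^ dd)
    (hK : ∀ R : ℕ, ∑ r ∈ range (R + 1), Real.exp (-((α * δ₀) * r)) * F261 N dd Lr A r ≤ K) :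
    B6Lemma21Repaired.Ineq262With K g δ₀ α :=
  B6Lemma21Repaired.ineq262With_of_261With
    (ineq261With_of_realizes hreal hι hconn hgap hN hbond hmono hℓpos hℓL hLr hA hpack hK)

/-- **(2.63) (two-point chain bound) from this (2.61)** and the triangle inequality (2.54) of realised geometries
(`B6Geometry.triangle254_of_realizes`), `δ₀ ≥ 0`, `α ≤ 1`, by `B6Lemma21Repaired.ineq263With_of_261With`.
[cite: Balaban1984PropagatorsII, (2.63) p.234, (2.54) p.233] -/
theorem ineq263With_of_realizes {δ₀ α K : ℝ} (hreal : Realizes g C) (hι : Function.Injective C.ι)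
    (hconn : C.bond.Connected) (hgap : LevelGap C.bond C.zone N) (hN : 0 < N) (hbond : BondScale C.bond C.zone pos ℓ)
    (hmono : Monotone ℓ) (hℓpos : ∀ n, 0 < ℓ n) (hℓL : ∀ n, ℓ (n + 1) ≤ Lr * ℓ n) (hLr : 1 ≤ Lr) (hA : 0 ≤ A)
    (hpack : ∀ (j : ℕ) (p : X) (R : ℝ) (S : Finset C.Pt), 0 ≤ R → (∀ v ∈ S, C.zone v = j ∧ dist (pos v) p ≤ R) →
      (#S : ℝ) ≤ (2 * R / ℓ j + A) ^ dd)
    (hδ₀ : 0 ≤ δ₀) (hα : α ≤ 1)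
    (hK : ∀ R : ℕ, ∑ r ∈ range (R + 1), Real.exp (-((α * δ₀) * r)) * F261 N dd Lr A r ≤ K) :
    B6Lemma21Repaired.Ineq263With K g δ₀ α :=
  B6Lemma21Repaired.ineq263With_of_261With (triangle254_of_realizes hreal hconn) hδ₀ hα
    (ineq261With_of_realizes hreal hι hconn hgap hN hbond hmono hℓpos hℓL hLr hA hpack hK)

/-- **(2.61) with the series constant `K261`** under the (2.59)-shape condition `e^{−σ}·L^{2dd/N} < 1`.
[cite: Balaban1984PropagatorsII, Lemma 2.1 (2.61) p.234, (2.59) p.233] -/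
theorem rowSum_K261_of_realizes {σ : ℝ} (hreal : Realizes g C) (hι : Function.Injective C.ι) (hconn : C.bond.Connected)
    (hgap : LevelGap C.bond C.zone N) (hN : 0 < N) (hbond : BondScale C.bond C.zone pos ℓ) (hmono : Monotone ℓ)
    (hℓpos : ∀ n, 0 < ℓ n) (hℓL : ∀ n, ℓ (n + 1) ≤ Lr * ℓ n) (hLr : 1 ≤ Lr) (hA : 0 ≤ A)
    (hpack : ∀ (j : ℕ) (p : X) (R : ℝ) (S : Finset C.Pt), 0 ≤ R → (∀ v ∈ S, C.zone v = j ∧ dist (pos v) p ≤ R) →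
      (#S : ℝ) ≤ (2 * R / ℓ j + A) ^ dd)
    (hθ : Real.exp (-σ) * Lr ^ ((2 * dd : ℝ) / N) < 1) :
    RowSum g σ (K261 N dd Lr A σ) :=
  rowSum_of_realizes hreal hι hconn hgap hN hbond hmono hℓpos hℓL hLr hA hpack
    (partialSum_le_K261 (by linarith) hA (summable_K261 hN hLr hA hθ))

end Realised

/-! ## §7. The ℤᵈ nested-cube systems of `B15Ineq147LevelGap` -/

section Cube

open B15Ineq147LevelGap

variable {d : ℕ} {M₁ L : ℕ} {Z : ℕ → Set (Fin d → ℤ)}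

/-- The cube scales are geometric: `M₁L^{n+1} = L·(M₁Lⁿ)`. [cite: Balaban1989LargeFieldI, p.186] -/
theorem scaleC_succ_le (M₁ L n : ℕ) : scaleC M₁ L (n + 1) ≤ (L : ℝ) * scaleC M₁ L n := by
  unfold scaleC; rw [pow_succ]; ring_nf; rfl

/-- The cube scales are monotone for `L ≥ 1`. [cite: Balaban1989LargeFieldI, p.186] -/
theorem scaleC_mono (hL : 1 ≤ L) : Monotone (scaleC M₁ L) := by
  intro a b hab
  unfold scaleC
  have hL' : (1 : ℝ) ≤ L := by exact_mod_cast hL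
  have := pow_le_pow_right₀ hL' hab
  have hM : (0 : ℝ) ≤ M₁ := Nat.cast_nonneg M₁
  nlinarith

/-- The cube scales are positive for `M₁, L ≥ 1`. [cite: Balaban1989LargeFieldI, p.186] -/
theorem scaleC_pos (hM₁ : 0 < M₁) (hL : 0 < L) (n : ℕ) : 0 < scaleC M₁ L n := by
  unfold scaleC
  have : (0 : ℝ) < M₁ := by exact_mod_cast hM₁
  have : (0 : ℝ) < (L : ℝ) ^ n := pow_pos (by exact_mod_cast hL) n
  positivity

/-- **Per-scale packing of the cube systems**: a finite set of scale-`j` cube-sites whose corners lie within sup-distance `R` of a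
point `p ∈ ℝᵈ` has at most `(2R/(M₁L^j) + 1)^d` elements — the corners run over the grid `M₁L^j·ℤᵈ`, and an interval of length
`2R` contains at most `2R/(M₁L^j) + 1` grid points per coordinate. [cite: Balaban1989LargeFieldI, condition (i) p.177, p.186] -/
theorem pack_cube (hM₁ : 0 < M₁) (hL : 0 < L) (j : ℕ) (p : Fin d → ℝ) (R : ℝ) (S : Finset (CubeSite M₁ L Z)) (hR : 0 ≤ R)
    (hS : ∀ s ∈ S, zoneC s = j ∧ dist (posC s) p ≤ R) :
    (#S : ℝ) ≤ (2 * R / scaleC M₁ L j + 1) ^ d := by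
  classical
  set sℓ : ℝ := scaleC M₁ L j with hsℓ
  have hsℓ0 : 0 < sℓ := scaleC_pos hM₁ hL j
  -- the index box: c_μ ∈ [⌈(p_μ − R)/ℓ⌉, ⌊(p_μ + R)/ℓ⌋]
  set lo : Fin d → ℤ := fun μ => ⌈(p μ - R) / sℓ⌉ with hlo
  set hi : Fin d → ℤ := fun μ => ⌊(p μ + R) / sℓ⌋ with hhi
  set B : Finset (Fin d → ℤ) := Fintype.piFinset fun μ => Finset.Icc (lo μ) (hi μ) with hB
  -- the index map s ↦ c is injective on S (fixed scale j) and lands in the box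
  have hinj : Set.InjOn (fun s : CubeSite M₁ L Z => s.1.2) S := by
    intro s hs t ht hst
    have hs1 : s.1.1 = j := (hS s hs).1
    have ht1 : t.1.1 = j := (hS t ht).1
    apply Subtype.ext
    exact Prod.ext (hs1.trans ht1.symm) hst
  have hmaps : ∀ s ∈ S, (fun s : CubeSite M₁ L Z => s.1.2) s ∈ B := by
    intro s hs
    obtain ⟨hz, hdist⟩ := hS s hs
    rw [hB, Fintype.mem_piFinset]
    intro μ
    rw [Finset.mem_Icc]
    -- |M₁L^j c_μ − p_μ| ≤ R
    have hcoord : dist (posC s μ) (p μ) ≤ R := (dist_le_pi_dist (posC s) p μ).trans hdist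
    rw [Real.dist_eq, abs_le] at hcoord
    have hpos : posC s μ = sℓ * (s.1.2 μ : ℝ) := by
      simp only [posC, toR, corner, hsℓ, scaleC, mul_one]
      have : s.1.1 = j := hz
      rw [this]; push_cast; ring
    rw [hpos] at hcoord
    constructor
    · -- ⌈(p_μ − R)/ℓ⌉ ≤ c_μ
      rw [hlo]
      refine Int.ceil_le.mpr ?_
      rw [div_le_iff₀ hsℓ0]
      linarith [hcoord.1]
    · rw [hhi]
      refine Int.le_floor.mpr ?_
      rw [le_div_iff₀ hsℓ0]
      linarith [hcoord.2]
  have hcardS : #S ≤ #B := Finset.card_le_card_of_injOn _ hmaps hinj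
  -- the box has ≤ (2R/ℓ + 1)^d points
  have hcoordcard : ∀ μ, (#(Finset.Icc (lo μ) (hi μ)) : ℝ) ≤ 2 * R / sℓ + 1 := by
    intro μ
    rw [Int.card_Icc]
    have h1 : ((hi μ + 1 - lo μ).toNat : ℝ) ≤ max ((hi μ : ℝ) + 1 - lo μ) 0 := by
      rcases le_or_gt 0 (hi μ + 1 - lo μ) with h | h
      · have e : ((hi μ + 1 - lo μ).toNat : ℝ) = (hi μ : ℝ) + 1 - lo μ := by
          exact_mod_cast Int.toNat_of_nonneg h
        rw [e]; exact le_max_left _ _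
      · rw [Int.toNat_eq_zero.mpr h.le]; push_cast; exact le_max_right _ _
    refine h1.trans (max_le ?_ (by positivity))
    have hhi' : (hi μ : ℝ) ≤ (p μ + R) / sℓ := Int.floor_le _
    have hlo' : (p μ - R) / sℓ ≤ (lo μ : ℝ) := Int.le_ceil _
    have : (p μ + R) / sℓ - (p μ - R) / sℓ = 2 * R / sℓ := by field_simp; ring
    linarith
  have hBcard : (#B : ℝ) ≤ (2 * R / sℓ + 1) ^ d := by
    rw [hB, Fintype.card_piFinset]
    push_cast
    calc ∏ μ : Fin d, (#(Finset.Icc (lo μ) (hi μ)) : ℝ) ≤ ∏ _μ : Fin d, (2 * R / sℓ + 1) :=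
          Finset.prod_le_prod (fun μ _ => Nat.cast_nonneg _) (fun μ _ => hcoordcard μ)
      _ = (2 * R / sℓ + 1) ^ d := by rw [Finset.prod_const, Finset.card_univ, Fintype.card_fin]
  calc (#S : ℝ) ≤ #B := by exact_mod_cast hcardS
    _ ≤ (2 * R / sℓ + 1) ^ d := hBcard

/-- **Lemma 2.1 (2.61) for every geometry realised by a ℤᵈ nested-cube contour system** of `B15Ineq147LevelGap`: sites =
`M₁`-cubes *"on corresponding scales"* in the layers `Z″_{n+1}∖Z″_n` of nested `Z″_n ⊂ ℤᵈ` (`Monotone Z`) separated by one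
layer of `ML^{n+1}`-cubes (`LayerSepZd Z M L`), `L ≥ 2`, `M₁ ≥ 1`, `M₁ ∣ M` (so the walk form of (2.2) holds with `N = M/M₁`,
`levelGap_cube`), bonds `bondC` (`bondScale_cube`), admissible contours exist (`Connected`), `g.dist` = the contour distance and
the sites of `g` injected into the cube-sites: `RowSum g σ (K261 (M/M₁) d L 1 σ)` under `e^{−σ}·L^{2d/(M/M₁)} < 1` — the
hypothesis `hrow` of the (190)-knits DISCHARGED on these geometries. [cite: Balaban1984PropagatorsII, Lemma 2.1 (2.61) p.234, (2.2) p.224; Balaban1989LargeFieldI, p.179, p.186] -/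
theorem rowSum_cube {g : B6.Geometry} {M : ℕ} {σ : ℝ} (ι : g.Site → CubeSite M₁ L Z) (hι : Function.Injective ι)
    (hzone : ∀ y, zoneC (ι y) = g.scale y)
    (hdist : ∀ y y', g.dist y y' = ((bondC M₁ L Z).dist (ι y) (ι y') : ℝ))
    (hconn : (bondC M₁ L Z).Connected) (hmono : Monotone Z) (hsep : LayerSepZd Z M L) (hM : 0 < M) (hM₁ : 0 < M₁)
    (hdvd : M₁ ∣ M) (hMM₁ : M₁ ≤ M) (hL : 2 ≤ L)
    (hθ : Real.exp (-σ) * (L : ℝ) ^ ((2 * d : ℝ) / (M / M₁ : ℕ)) < 1) :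
    RowSum g σ (K261 (M / M₁) d L 1 σ) := by
  let C : ContourSystem g := ⟨CubeSite M₁ L Z, bondC M₁ L Z, ι, zoneC, hzone⟩
  have hreal : Realizes g C := fun y y' => hdist y y'
  have hN : 0 < M / M₁ := Nat.div_pos hMM₁ hM₁
  exact rowSum_K261_of_realizes (C := C) (pos := posC) (ℓ := scaleC M₁ L) hreal hι hconn
    (levelGap_cube hmono hsep hM hM₁ hdvd hL) hN bondScale_cube (scaleC_mono (by omega))
    (scaleC_pos hM₁ (by omega)) (scaleC_succ_le M₁ L) (by exact_mod_cast (show 1 ≤ L by omega)) zero_le_one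
    (fun j p R S hR hS => pack_cube hM₁ (by omega) j p R S hR hS) hθ

end Cube

/-! ## §8 (v1.1, append-only). The coarse-scale bond variant: `dist(pos u, pos v) ≤ ℓ(max(zone u, zone v))` -/

section GraphMax

variable {V X : Type*} [PseudoMetricSpace X] {G : SimpleGraph V} {zone : V → ℕ} {pos : V → X} {ℓ : ℕ → ℝ} {N : ℕ}

/-- `BondScale` (bond length ≤ the FINER scale) implies the coarse-scale bound (bond length ≤ the COARSER scale) for monotone
scales. [cite: Balaban1984PropagatorsII, (2.46) p.231] -/
theorem bondMax_of_bondScale (hbond : BondScale G zone pos ℓ) (hmono : Monotone ℓ) :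
    ∀ ⦃u v : V⦄, G.Adj u v → dist (pos u) (pos v) ≤ ℓ (max (zone u) (zone v)) :=
  fun _ _ h => (hbond h).trans (hmono (min_le_max))

/-- **Displacement along a contour inside the ball, coarse-scale bonds**: as `disp_walk`, every bond read at the COARSER of its two
scales — both end-points of a bond of the contour lie in the zone window, so the bound `|p|·ℓ(zone y + r/N + 1)` is unchanged.
[cite: Balaban1984PropagatorsII, (2.46)–(2.48) pp.231–232] -/
theorem disp_walk_max (hconn : G.Connected) (hgap : LevelGap G zone N) (hN : 0 < N)
    (hbond : ∀ ⦃u v : V⦄, G.Adj u v → dist (pos u) (pos v) ≤ ℓ (max (zone u) (zone v))) (hmono : Monotone ℓ) (y : V)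
    (r : ℕ) :
    ∀ {u v : V} (p : G.Walk u v), G.dist y u + p.length ≤ r →
      dist (pos u) (pos v) ≤ p.length * ℓ (zone y + (r / N + 1)) := by
  intro u v p
  induction p with
  | nil => intro _; simp
  | @cons u w v hadj q ih =>
    intro hlen
    rw [SimpleGraph.Walk.length_cons] at hlen
    have hdu : G.dist y u ≤ r := by omega
    have h1 : G.dist u w ≤ 1 := by
      have := SimpleGraph.dist_le hadj.toWalk
      simpa using this
    have hdw : G.dist y w ≤ G.dist y u + 1 :=
      (hconn.dist_triangle (u := y) (v := u) (w := w)).trans (by omega)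
    have ih' := ih (by omega)
    have hzu : zone u ≤ zone y + (r / N + 1) := (zone_window hconn hgap hN hdu).1
    have hzw : zone w ≤ zone y + (r / N + 1) := (zone_window hconn hgap hN (show G.dist y w ≤ r by omega)).1
    have hstep : dist (pos u) (pos w) ≤ ℓ (zone y + (r / N + 1)) :=
      (hbond hadj).trans (hmono (max_le hzu hzw))
    calc dist (pos u) (pos v) ≤ dist (pos u) (pos w) + dist (pos w) (pos v) := dist_triangle _ _ _
      _ ≤ ℓ (zone y + (r / N + 1)) + q.length * ℓ (zone y + (r / N + 1)) := add_le_add hstep ih'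
      _ = (SimpleGraph.Walk.cons hadj q).length * ℓ (zone y + (r / N + 1)) := by
          rw [SimpleGraph.Walk.length_cons]; push_cast; ring

/-- **Displacement bound of a graph ball, coarse-scale bonds**: `d(y, v) ≤ r ⇒ dist(pos y, pos v) ≤ r·ℓ(zone y + r/N + 1)`.
[cite: Balaban1984PropagatorsII, (2.46)–(2.48) pp.231–232] -/
theorem disp_le_of_dist_le_max (hconn : G.Connected) (hgap : LevelGap G zone N) (hN : 0 < N)
    (hbond : ∀ ⦃u v : V⦄, G.Adj u v → dist (pos u) (pos v) ≤ ℓ (max (zone u) (zone v))) (hmono : Monotone ℓ)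
    (hℓ0 : ∀ n, 0 ≤ ℓ n) {y v : V} {r : ℕ} (h : G.dist y v ≤ r) :
    dist (pos y) (pos v) ≤ r * ℓ (zone y + (r / N + 1)) := by
  obtain ⟨p, hp⟩ := hconn.exists_walk_length_eq_dist y v
  have h1 := disp_walk_max hconn hgap hN hbond hmono y r p (by rw [SimpleGraph.dist_self, hp]; omega)
  rw [hp] at h1
  exact h1.trans (mul_le_mul_of_nonneg_right (by exact_mod_cast h) (hℓ0 _))

/-- **At most `F(r)` points within graph distance `r`, coarse-scale bonds** (packing; as `card_le_F261_of_dist_le`).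
[cite: Balaban1984PropagatorsII, (2.58) p.233, (2.61) p.234] -/
theorem card_le_F261_of_dist_le_max {dd : ℕ} {Lr A : ℝ} (hconn : G.Connected) (hgap : LevelGap G zone N) (hN : 0 < N)
    (hbond : ∀ ⦃u v : V⦄, G.Adj u v → dist (pos u) (pos v) ≤ ℓ (max (zone u) (zone v))) (hmono : Monotone ℓ)
    (hℓpos : ∀ n, 0 < ℓ n) (hℓL : ∀ n, ℓ (n + 1) ≤ Lr * ℓ n) (hLr : 1 ≤ Lr) (hA : 0 ≤ A)
    (hpack : ∀ (j : ℕ) (p : X) (R : ℝ) (S : Finset V), 0 ≤ R → (∀ v ∈ S, zone v = j ∧ dist (pos v) p ≤ R) →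
      (#S : ℝ) ≤ (2 * R / ℓ j + A) ^ dd)
    (y : V) (r : ℕ) (S : Finset V) (hS : ∀ v ∈ S, G.dist y v ≤ r) :
    (#S : ℝ) ≤ F261 N dd Lr A r := by
  classical
  have hℓ0 : ∀ n, 0 ≤ ℓ n := fun n => (hℓpos n).le
  set m : ℕ := r / N + 1 with hm
  set Z : ℕ := zone y + m with hZ
  set Rad : ℝ := (r : ℝ) * ℓ Z with hRad
  have hRad0 : 0 ≤ Rad := mul_nonneg (Nat.cast_nonneg r) (hℓ0 Z)
  have hwin : ∀ v ∈ S, zone v ∈ Icc (zone y - m) Z := fun v hv => by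
    have := zone_window hconn hgap hN (hS v hv)
    rw [mem_Icc]; constructor <;> omega
  have hball : ∀ v ∈ S, dist (pos v) (pos y) ≤ Rad := fun v hv => by
    rw [dist_comm]; exact disp_le_of_dist_le_max hconn hgap hN hbond hmono hℓ0 (hS v hv)
  have hzone : ∀ j' ∈ Icc (zone y - m) Z,
      (#{v ∈ S | zone v = j'} : ℝ) ≤ (2 * (r : ℝ) * Lr ^ (2 * m) + A) ^ dd := by
    intro j' hj'
    rw [mem_Icc] at hj'
    have h1 := hpack j' (pos y) Rad {v ∈ S | zone v = j'} hRad0 (fun v hv => by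
      rw [mem_filter] at hv
      exact ⟨hv.2, hball v hv.1⟩)
    have hnn : 0 ≤ 2 * Rad / ℓ j' + A := add_nonneg (div_nonneg (mul_nonneg (by norm_num) hRad0) (hℓ0 j')) hA
    refine h1.trans (pow_le_pow_left₀ hnn ?_ dd)
    have hZj : Z - j' ≤ 2 * m := by omega
    have hratio : ℓ Z ≤ Lr ^ (2 * m) * ℓ j' := by
      have e : Z = j' + (Z - j') := by omega
      calc ℓ Z = ℓ (j' + (Z - j')) := by rw [← e]
        _ ≤ Lr ^ (Z - j') * ℓ j' := scale_ratio_le hℓL hLr j' (Z - j')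
        _ ≤ Lr ^ (2 * m) * ℓ j' := mul_le_mul_of_nonneg_right (pow_le_pow_right₀ hLr hZj) (hℓ0 j')
    have hkey : 2 * Rad / ℓ j' ≤ 2 * (r : ℝ) * Lr ^ (2 * m) := by
      rw [div_le_iff₀ (hℓpos j'), hRad]
      have hr0 : (0 : ℝ) ≤ 2 * (r : ℝ) := by positivity
      calc 2 * ((r : ℝ) * ℓ Z) = 2 * (r : ℝ) * ℓ Z := by ring
        _ ≤ 2 * (r : ℝ) * (Lr ^ (2 * m) * ℓ j') := mul_le_mul_of_nonneg_left hratio hr0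
        _ = 2 * (r : ℝ) * Lr ^ (2 * m) * ℓ j' := by ring
    linarith
  have hcard : (#S : ℝ) = ∑ j' ∈ Icc (zone y - m) Z, (#{v ∈ S | zone v = j'} : ℝ) := by
    have := Finset.card_eq_sum_card_fiberwise (f := zone) (s := S) (t := Icc (zone y - m) Z) hwin
    rw [this]; push_cast; rfl
  have hIcc : (#(Icc (zone y - m) Z) : ℝ) ≤ 2 * (m : ℝ) + 1 := by
    rw [Nat.card_Icc]
    have : Z + 1 - (zone y - m) ≤ 2 * m + 1 := by omega
    exact_mod_cast this
  calc (#S : ℝ) = ∑ j' ∈ Icc (zone y - m) Z, (#{v ∈ S | zone v = j'} : ℝ) := hcard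
    _ ≤ ∑ j' ∈ Icc (zone y - m) Z, (2 * (r : ℝ) * Lr ^ (2 * m) + A) ^ dd := sum_le_sum hzone
    _ = (#(Icc (zone y - m) Z) : ℝ) * (2 * (r : ℝ) * Lr ^ (2 * m) + A) ^ dd := by rw [sum_const, nsmul_eq_mul]
    _ ≤ (2 * (m : ℝ) + 1) * (2 * (r : ℝ) * Lr ^ (2 * m) + A) ^ dd :=
        mul_le_mul_of_nonneg_right hIcc (by positivity)
    _ = F261 N dd Lr A r := by simp only [F261, hm]

/-- **(2.61) over a finite set of points, coarse-scale bonds** (as `sum_exp_dist_le`). [cite: Balaban1984PropagatorsII, Lemma 2.1 (2.61) p.234] -/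
theorem sum_exp_dist_le_max {dd : ℕ} {Lr A σ K : ℝ} (hconn : G.Connected) (hgap : LevelGap G zone N) (hN : 0 < N)
    (hbond : ∀ ⦃u v : V⦄, G.Adj u v → dist (pos u) (pos v) ≤ ℓ (max (zone u) (zone v))) (hmono : Monotone ℓ)
    (hℓpos : ∀ n, 0 < ℓ n) (hℓL : ∀ n, ℓ (n + 1) ≤ Lr * ℓ n) (hLr : 1 ≤ Lr) (hA : 0 ≤ A)
    (hpack : ∀ (j : ℕ) (p : X) (R : ℝ) (S : Finset V), 0 ≤ R → (∀ v ∈ S, zone v = j ∧ dist (pos v) p ≤ R) →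
      (#S : ℝ) ≤ (2 * R / ℓ j + A) ^ dd)
    (hK : ∀ R : ℕ, ∑ r ∈ range (R + 1), Real.exp (-(σ * r)) * F261 N dd Lr A r ≤ K)
    (y : V) (S : Finset V) :
    ∑ v ∈ S, Real.exp (-(σ * G.dist y v)) ≤ K := by
  classical
  set D : ℕ := S.sup (fun v => G.dist y v) with hD
  have hmaps : ∀ v ∈ S, G.dist y v ∈ range (D + 1) := fun v hv =>
    mem_range.mpr (Nat.lt_succ_of_le (Finset.le_sup (f := fun v => G.dist y v) hv))
  rw [← Finset.sum_fiberwise_of_maps_to hmaps]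
  refine le_trans (sum_le_sum fun r _ => ?_) (hK D)
  have hshell : ∑ v ∈ S with G.dist y v = r, Real.exp (-(σ * G.dist y v)) =
      (#{v ∈ S | G.dist y v = r} : ℝ) * Real.exp (-(σ * r)) := by
    rw [Finset.card_eq_sum_ones, Nat.cast_sum, Finset.sum_mul]
    refine Finset.sum_congr rfl fun v hv => ?_
    rw [(Finset.mem_filter.mp hv).2]
    simp
  rw [hshell, mul_comm]
  refine mul_le_mul_of_nonneg_left ?_ (Real.exp_pos _).le
  exact card_le_F261_of_dist_le_max hconn hgap hN hbond hmono hℓpos hℓL hLr hA hpack y r _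
    (fun v hv => ((mem_filter.mp hv).2).le)

end GraphMax

section RealisedMax

variable {g : B6.Geometry} {C : ContourSystem g} {X : Type*} [PseudoMetricSpace X] {pos : C.Pt → X} {ℓ : ℕ → ℝ}
  {N dd : ℕ} {Lr A : ℝ}

/-- **Lemma 2.1 (2.61) for realised contour systems, coarse-scale bonds** (`RowSum g σ K`): as `rowSum_of_realizes` with the bond
hypothesis weakened to `dist(pos u, pos v) ≤ ℓ(max(zone u, zone v))`. [cite: Balaban1984PropagatorsII, Lemma 2.1 (2.61) p.234, (2.2) p.224, (2.46) p.231] -/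
theorem rowSum_of_realizes_max {σ K : ℝ} (hreal : Realizes g C) (hι : Function.Injective C.ι) (hconn : C.bond.Connected)
    (hgap : LevelGap C.bond C.zone N) (hN : 0 < N)
    (hbond : ∀ ⦃u v : C.Pt⦄, C.bond.Adj u v → dist (pos u) (pos v) ≤ ℓ (max (C.zone u) (C.zone v)))
    (hmono : Monotone ℓ) (hℓpos : ∀ n, 0 < ℓ n) (hℓL : ∀ n, ℓ (n + 1) ≤ Lr * ℓ n) (hLr : 1 ≤ Lr) (hA : 0 ≤ A)
    (hpack : ∀ (j : ℕ) (p : X) (R : ℝ) (S : Finset C.Pt), 0 ≤ R → (∀ v ∈ S, C.zone v = j ∧ dist (pos v) p ≤ R) →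
      (#S : ℝ) ≤ (2 * R / ℓ j + A) ^ dd)
    (hK : ∀ R : ℕ, ∑ r ∈ range (R + 1), Real.exp (-(σ * r)) * F261 N dd Lr A r ≤ K) :
    RowSum g σ K := by
  classical
  intro y
  have hre : ∀ y', Real.exp (-(σ * g.dist y y')) = Real.exp (-(σ * (C.bond.dist (C.ι y) (C.ι y') : ℕ))) := fun y' => by
    rw [hreal y y']; rfl
  simp_rw [hre]
  rw [← Finset.sum_image (f := fun v => Real.exp (-(σ * (C.bond.dist (C.ι y) v : ℕ))))
    (fun a _ b _ h => hι h)]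
  exact sum_exp_dist_le_max hconn hgap hN hbond hmono hℓpos hℓL hLr hA hpack hK (C.ι y) _

/-- **(2.61) with the series constant, coarse-scale bonds**, under `e^{−σ}·L^{2dd/N} < 1`.
[cite: Balaban1984PropagatorsII, Lemma 2.1 (2.61) p.234, (2.59) p.233] -/
theorem rowSum_K261_of_realizes_max {σ : ℝ} (hreal : Realizes g C) (hι : Function.Injective C.ι)
    (hconn : C.bond.Connected) (hgap : LevelGap C.bond C.zone N) (hN : 0 < N)
    (hbond : ∀ ⦃u v : C.Pt⦄, C.bond.Adj u v → dist (pos u) (pos v) ≤ ℓ (max (C.zone u) (C.zone v)))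
    (hmono : Monotone ℓ) (hℓpos : ∀ n, 0 < ℓ n) (hℓL : ∀ n, ℓ (n + 1) ≤ Lr * ℓ n) (hLr : 1 ≤ Lr) (hA : 0 ≤ A)
    (hpack : ∀ (j : ℕ) (p : X) (R : ℝ) (S : Finset C.Pt), 0 ≤ R → (∀ v ∈ S, C.zone v = j ∧ dist (pos v) p ≤ R) →
      (#S : ℝ) ≤ (2 * R / ℓ j + A) ^ dd)
    (hθ : Real.exp (-σ) * Lr ^ ((2 * dd : ℝ) / N) < 1) :
    RowSum g σ (K261 N dd Lr A σ) :=
  rowSum_of_realizes_max hreal hι hconn hgap hN hbond hmono hℓpos hℓL hLr hA hpack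
    (partialSum_le_K261 (by linarith) hA (summable_K261 hN hLr hA hθ))

end RealisedMax

section CubeMax

open B15Ineq147LevelGap

variable {d : ℕ} {M₁ L : ℕ} {Z : ℕ → Set (Fin d → ℤ)}

/-- **(2.61) for a geometry realised by ANY bond graph on the cube-sites whose bonds stay within the coarser scale** — e.g. the
graph of TOUCHING cubes of equal or consecutive scales represented by their corners (corner distance ≤ the coarser side): given
its walk form of (2.2) `LevelGap G zoneC N` (N ≥ 1) and connectedness, `RowSum g σ (K261 N d L 1 σ)` under
`e^{−σ}·L^{2d/N} < 1`, `M₁ ≥ 1`, `L ≥ 1` (packing by `pack_cube`). [cite: Balaban1984PropagatorsII, Lemma 2.1 (2.61) p.234; Balaban1989LargeFieldI, p.179, p.186] -/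
theorem rowSum_cubeSites {g : B6.Geometry} {N : ℕ} {σ : ℝ} (G : SimpleGraph (CubeSite M₁ L Z))
    (ι : g.Site → CubeSite M₁ L Z) (hι : Function.Injective ι) (hzone : ∀ y, zoneC (ι y) = g.scale y)
    (hdist : ∀ y y', g.dist y y' = (G.dist (ι y) (ι y') : ℝ)) (hconn : G.Connected) (hgap : LevelGap G zoneC N)
    (hN : 0 < N) (hadj : ∀ ⦃s t : CubeSite M₁ L Z⦄, G.Adj s t → dist (posC s) (posC t) ≤ scaleC M₁ L (max (zoneC s) (zoneC t)))
    (hM₁ : 0 < M₁) (hL : 1 ≤ L) (hθ : Real.exp (-σ) * (L : ℝ) ^ ((2 * d : ℝ) / N) < 1) :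
    RowSum g σ (K261 N d L 1 σ) := by
  let C : ContourSystem g := ⟨CubeSite M₁ L Z, G, ι, zoneC, hzone⟩
  have hreal : Realizes g C := fun y y' => hdist y y'
  exact rowSum_K261_of_realizes_max (C := C) (pos := posC) (ℓ := scaleC M₁ L) hreal hι hconn hgap hN hadj
    (scaleC_mono hL) (scaleC_pos hM₁ (by omega)) (scaleC_succ_le M₁ L) (by exact_mod_cast hL) zero_le_one
    (fun j p R S hR hS => pack_cube hM₁ (by omega) j p R S hR hS) hθ

end CubeMax

/-! ## §9 (v1.1). The constant in closed form -/

section ClosedForm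

/-- **The (2.61) constant in closed form**: `K261 N dd L A σ ≤ 3(A+2)^{dd}L^{2dd}·(dd+1)!/(1 − θ)^{dd+2}` with `θ = e^{−σ}·L^{2dd/N} < 1`
— from `F261_le_geometric`, `(r+1)^{dd+1} ≤ (r+1)(r+2)⋯(r+dd+1) = (dd+1)!·C(r+dd+1, dd+1)` and the negative-binomial series
`Σ_r C(r+k, k)θ^r = 1/(1 − θ)^{k+1}`. [cite: Balaban1984PropagatorsII, Lemma 2.1 (2.61) p.234, (2.59) p.233] -/
theorem K261_le_closedForm {N dd : ℕ} {Lr A σ : ℝ} (hN : 0 < N) (hLr : 1 ≤ Lr) (hA : 0 ≤ A)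
    (hθ : Real.exp (-σ) * Lr ^ ((2 * dd : ℝ) / N) < 1) :
    K261 N dd Lr A σ ≤ (3 * (A + 2) ^ dd * Lr ^ (2 * dd)) * ((dd + 1).factorial *
      (1 / (1 - Real.exp (-σ) * Lr ^ ((2 * dd : ℝ) / N)) ^ (dd + 2))) := by
  set θ : ℝ := Real.exp (-σ) * Lr ^ ((2 * dd : ℝ) / N) with hθdef
  have hθ0 : 0 ≤ θ := by positivity
  have hθn : ‖θ‖ < 1 := by rw [Real.norm_eq_abs, abs_of_nonneg hθ0]; exact hθ
  set Cst : ℝ := 3 * (A + 2) ^ dd * Lr ^ (2 * dd) with hCst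
  have hCst0 : 0 ≤ Cst := by positivity
  -- the negative-binomial series with k = dd + 1
  have hHS := hasSum_choose_mul_geometric_of_norm_lt_one (dd + 1) hθn
  have hsumB : Summable (fun r : ℕ => (((r + (dd + 1)).choose (dd + 1) : ℕ) : ℝ) * θ ^ r) := hHS.summable
  -- majorant: e^{−σr}F(r) ≤ Cst·(dd+1)!·C(r+dd+1,dd+1)·θ^r
  have hmaj : ∀ r : ℕ, Real.exp (-(σ * r)) * F261 N dd Lr A r ≤
      Cst * ((dd + 1).factorial * ((((r + (dd + 1)).choose (dd + 1) : ℕ) : ℝ) * θ ^ r)) := by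
    intro r
    have h1 := F261_le_geometric (dd := dd) (σ := σ) hN hLr hA r
    have h2 : ((r : ℝ) + 1) ^ (dd + 1) ≤ ((dd + 1).factorial : ℝ) * (((r + (dd + 1)).choose (dd + 1) : ℕ) : ℝ) := by
      have hn := Nat.pow_succ_le_ascFactorial (r + 1) (dd + 1)
      rw [Nat.ascFactorial_eq_factorial_mul_choose] at hn
      exact_mod_cast hn
    calc Real.exp (-(σ * r)) * F261 N dd Lr A r ≤ Cst * (((r : ℝ) + 1) ^ (dd + 1) * θ ^ r) := h1
      _ ≤ Cst * ((((dd + 1).factorial : ℝ) * (((r + (dd + 1)).choose (dd + 1) : ℕ) : ℝ)) * θ ^ r) :=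
          mul_le_mul_of_nonneg_left (mul_le_mul_of_nonneg_right h2 (pow_nonneg hθ0 r)) hCst0
      _ = Cst * ((dd + 1).factorial * ((((r + (dd + 1)).choose (dd + 1) : ℕ) : ℝ) * θ ^ r)) := by ring
  have hsumMaj : Summable (fun r : ℕ =>
      Cst * ((dd + 1).factorial * ((((r + (dd + 1)).choose (dd + 1) : ℕ) : ℝ) * θ ^ r))) :=
    (hsumB.mul_left _).mul_left _
  have hsumF : Summable (fun r : ℕ => Real.exp (-(σ * r)) * F261 N dd Lr A r) := summable_K261 hN hLr hA hθ
  calc K261 N dd Lr A σ = ∑' r : ℕ, Real.exp (-(σ * r)) * F261 N dd Lr A r := rfl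
    _ ≤ ∑' r : ℕ, Cst * ((dd + 1).factorial * ((((r + (dd + 1)).choose (dd + 1) : ℕ) : ℝ) * θ ^ r)) :=
        hsumF.tsum_le_tsum hmaj hsumMaj
    _ = Cst * ((dd + 1).factorial * ∑' r : ℕ, (((r + (dd + 1)).choose (dd + 1) : ℕ) : ℝ) * θ ^ r) := by
        rw [tsum_mul_left, tsum_mul_left]
    _ = Cst * ((dd + 1).factorial * (1 / (1 - θ) ^ (dd + 1 + 1))) := by rw [hHS.tsum_eq]
    _ = Cst * ((dd + 1).factorial * (1 / (1 - θ) ^ (dd + 2))) := by norm_num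

end ClosedForm

/-! ## §10 (v1.2, append-only). Lemma 2.1 — all four displays (2.60)–(2.63) — on realised geometries -/

section Lemma21

variable {g : B6.Geometry} {C : ContourSystem g} {X : Type*} [PseudoMetricSpace X] {pos : C.Pt → X} {ℓ : ℕ → ℝ}
  {N dd : ℕ} {Lr A : ℝ}

/-- The (2.59)-shape summability condition in LOGARITHMIC form: `2·dd·log L < σ·N` gives `e^{−σ}·L^{2dd/N} < 1` — the shape of
print's *«Now we require that RM is sufficiently large, i.e. we assume ¼αδ₀RM > 2d log c₀(½α) + 1. (2.59)»* at fixed rate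
`σ = αδ₀`, with `L` in place of `c₀(½α)` (honest scope (i) of the header). [cite: Balaban1984PropagatorsII, (2.59) p.233] -/
theorem theta_lt_one_of_log {σ : ℝ} (hLr : 0 < Lr) (hN : 0 < N) (h : 2 * (dd : ℝ) * Real.log Lr < σ * N) :
    Real.exp (-σ) * Lr ^ ((2 * dd : ℝ) / N) < 1 := by
  have hN' : (0 : ℝ) < N := by exact_mod_cast hN
  rw [Real.rpow_def_of_pos hLr, ← Real.exp_add, Real.exp_lt_one_iff]
  have h1 : Real.log Lr * ((2 * dd : ℝ) / N) = 2 * (dd : ℝ) * Real.log Lr / N := by ring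
  have h2 : 2 * (dd : ℝ) * Real.log Lr / N < σ := by rw [div_lt_iff₀ hN']; linarith
  linarith

/-- **(2.61) in the shape `B6Lemma21Repaired.Ineq261With K g δ₀ α`, coarse-scale bonds** (from `rowSum_of_realizes_max`).
[cite: Balaban1984PropagatorsII, Lemma 2.1 (2.61) p.234] -/
theorem ineq261With_of_realizes_max {δ₀ α K : ℝ} (hreal : Realizes g C) (hι : Function.Injective C.ι)
    (hconn : C.bond.Connected) (hgap : LevelGap C.bond C.zone N) (hN : 0 < N)
    (hbond : ∀ ⦃u v : C.Pt⦄, C.bond.Adj u v → dist (pos u) (pos v) ≤ ℓ (max (C.zone u) (C.zone v)))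
    (hmono : Monotone ℓ) (hℓpos : ∀ n, 0 < ℓ n) (hℓL : ∀ n, ℓ (n + 1) ≤ Lr * ℓ n) (hLr : 1 ≤ Lr) (hA : 0 ≤ A)
    (hpack : ∀ (j : ℕ) (p : X) (R : ℝ) (S : Finset C.Pt), 0 ≤ R → (∀ v ∈ S, C.zone v = j ∧ dist (pos v) p ≤ R) →
      (#S : ℝ) ≤ (2 * R / ℓ j + A) ^ dd)
    (hK : ∀ R : ℕ, ∑ r ∈ range (R + 1), Real.exp (-((α * δ₀) * r)) * F261 N dd Lr A r ≤ K) :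
    B6Lemma21Repaired.Ineq261With K g δ₀ α := by
  intro y
  have h := rowSum_of_realizes_max hreal hι hconn hgap hN hbond hmono hℓpos hℓL hLr hA hpack hK y
  simpa [mul_assoc] using h

/-- **Lemma 2.1 — all four displays (2.60), (2.61), (2.62), (2.63) — for a REALISED contour system** with the walk form
`LevelGap N` of (2.2) (`N ≥ 1`, `RM ≤ N` for (2.60)), geometric bond scales (`BondScale`, `0 < ℓ n ≤ ℓ(n+1) ≤ L·ℓ n`, `L ≥ 1`)
and per-scale packing, at rate `αδ₀` with `δ₀ ≥ 0`, `0 ≤ α ≤ 1`, constant `K261 N dd L A (αδ₀)` under `e^{−αδ₀}·L^{2dd/N} < 1`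
((2.60) = `B6Geometry.ineq260_of_levelGap`; (2.61) = `ineq261With_of_realizes`; (2.62)/(2.63) by
`B6Lemma21Repaired.ineq262With_of_261With`/`ineq263With_of_261With`). [cite: Balaban1984PropagatorsII, Lemma 2.1 (2.60)–(2.63) p.234, (2.59) p.233] -/
theorem lemma21_of_realizes {δ₀ α : ℝ} (hreal : Realizes g C) (hι : Function.Injective C.ι) (hconn : C.bond.Connected)
    (hgap : LevelGap C.bond C.zone N) (hN : 0 < N) (hRM : g.R * g.M ≤ N) (hbond : BondScale C.bond C.zone pos ℓ)
    (hmono : Monotone ℓ) (hℓpos : ∀ n, 0 < ℓ n) (hℓL : ∀ n, ℓ (n + 1) ≤ Lr * ℓ n) (hLr : 1 ≤ Lr) (hA : 0 ≤ A)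
    (hpack : ∀ (j : ℕ) (p : X) (R : ℝ) (S : Finset C.Pt), 0 ≤ R → (∀ v ∈ S, C.zone v = j ∧ dist (pos v) p ≤ R) →
      (#S : ℝ) ≤ (2 * R / ℓ j + A) ^ dd)
    (hδ₀ : 0 ≤ δ₀) (hα0 : 0 ≤ α) (hα1 : α ≤ 1) (hθ : Real.exp (-(α * δ₀)) * Lr ^ ((2 * dd : ℝ) / N) < 1) :
    B6RandomWalk.Ineq260 g δ₀ α ∧ B6Lemma21Repaired.Ineq261With (K261 N dd Lr A (α * δ₀)) g δ₀ α ∧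
      B6Lemma21Repaired.Ineq262With (K261 N dd Lr A (α * δ₀)) g δ₀ α ∧
      B6Lemma21Repaired.Ineq263With (K261 N dd Lr A (α * δ₀)) g δ₀ α := by
  have hK := partialSum_le_K261 (N := N) (dd := dd) (σ := α * δ₀) (by linarith) hA (summable_K261 hN hLr hA hθ)
  have h261 := ineq261With_of_realizes hreal hι hconn hgap hN hbond hmono hℓpos hℓL hLr hA hpack hK
  exact ⟨ineq260_of_levelGap hreal hconn hgap hRM (mul_nonneg hα0 hδ₀), h261,
    B6Lemma21Repaired.ineq262With_of_261With h261,
    B6Lemma21Repaired.ineq263With_of_261With (triangle254_of_realizes hreal hconn) hδ₀ hα1 h261⟩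

/-- **Lemma 2.1 — all four displays — for a realised contour system, COARSE-SCALE bonds** (`dist(pos u, pos v) ≤
ℓ(max(zone u, zone v))` in place of `BondScale`), same constant and condition. [cite: Balaban1984PropagatorsII, Lemma 2.1 (2.60)–(2.63) p.234, (2.59) p.233] -/
theorem lemma21_of_realizes_max {δ₀ α : ℝ} (hreal : Realizes g C) (hι : Function.Injective C.ι)
    (hconn : C.bond.Connected) (hgap : LevelGap C.bond C.zone N) (hN : 0 < N) (hRM : g.R * g.M ≤ N)
    (hbond : ∀ ⦃u v : C.Pt⦄, C.bond.Adj u v → dist (pos u) (pos v) ≤ ℓ (max (C.zone u) (C.zone v)))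
    (hmono : Monotone ℓ) (hℓpos : ∀ n, 0 < ℓ n) (hℓL : ∀ n, ℓ (n + 1) ≤ Lr * ℓ n) (hLr : 1 ≤ Lr) (hA : 0 ≤ A)
    (hpack : ∀ (j : ℕ) (p : X) (R : ℝ) (S : Finset C.Pt), 0 ≤ R → (∀ v ∈ S, C.zone v = j ∧ dist (pos v) p ≤ R) →
      (#S : ℝ) ≤ (2 * R / ℓ j + A) ^ dd)
    (hδ₀ : 0 ≤ δ₀) (hα0 : 0 ≤ α) (hα1 : α ≤ 1) (hθ : Real.exp (-(α * δ₀)) * Lr ^ ((2 * dd : ℝ) / N) < 1) :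
    B6RandomWalk.Ineq260 g δ₀ α ∧ B6Lemma21Repaired.Ineq261With (K261 N dd Lr A (α * δ₀)) g δ₀ α ∧
      B6Lemma21Repaired.Ineq262With (K261 N dd Lr A (α * δ₀)) g δ₀ α ∧
      B6Lemma21Repaired.Ineq263With (K261 N dd Lr A (α * δ₀)) g δ₀ α := by
  have hK := partialSum_le_K261 (N := N) (dd := dd) (σ := α * δ₀) (by linarith) hA (summable_K261 hN hLr hA hθ)
  have h261 := ineq261With_of_realizes_max hreal hι hconn hgap hN hbond hmono hℓpos hℓL hLr hA hpack hK
  exact ⟨ineq260_of_levelGap hreal hconn hgap hRM (mul_nonneg hα0 hδ₀), h261,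
    B6Lemma21Repaired.ineq262With_of_261With h261,
    B6Lemma21Repaired.ineq263With_of_261With (triangle254_of_realizes hreal hconn) hδ₀ hα1 h261⟩

/-- **Lemma 2.1 — all four displays — with the geometric inputs in PRINTED shape**: a realised contour system whose admissible
bonds have the lattice lengths *«a part of Γ contained in B^j(Λ_j) consists of bonds of the lattice Λ_j»* (p. 231:
`B6LevelGapMetric.BondScale22 C pos`, ℓ j = L^jη), whose lattice points satisfy (2.2) *«(L^jη)^{−1} dist(Ω_j^c, Ω_{j+1}) > RM»*
(`B6LevelGapMetric.Cond22 C pos`) with `RM = N ≥ 1` a natural number (R *«a big positive integer»*, M the size of the big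
blocks), `L ≥ 1`, `η > 0`, and whose zone-`j` points are `(2R/(L^jη) + A)^{dd}`-packed in balls of radius R (the lattice
structure of Λ_j); then for `δ₀ ≥ 0`, `0 ≤ α ≤ 1` and `e^{−αδ₀}·L^{2dd/N} < 1` ((2.59)-shape, `theta_lt_one_of_log`):
(2.60) ∧ (2.61) ∧ (2.62) ∧ (2.63) with constant `K261 N dd L A (αδ₀)` — the walk form `LevelGap` DISCHARGED by
`B6LevelGapMetric.levelGap_of_cond22`. [cite: Balaban1984PropagatorsII, Lemma 2.1 (2.60)–(2.63) p.234, (2.2) p.224, p.231, (2.59) p.233] -/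
theorem lemma21_of_cond22 {δ₀ α : ℝ} (hreal : Realizes g C) (hι : Function.Injective C.ι) (hconn : C.bond.Connected)
    (hL : 1 ≤ g.L) (hη : 0 < g.eta) (hlen : BondScale22 C pos) (h22 : Cond22 C pos) (hN : 0 < N)
    (hRM : (N : ℝ) = g.R * g.M) (hA : 0 ≤ A)
    (hpack : ∀ (j : ℕ) (p : X) (R : ℝ) (S : Finset C.Pt), 0 ≤ R → (∀ v ∈ S, C.zone v = j ∧ dist (pos v) p ≤ R) →
      (#S : ℝ) ≤ (2 * R / (g.L ^ j * g.eta) + A) ^ dd)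
    (hδ₀ : 0 ≤ δ₀) (hα0 : 0 ≤ α) (hα1 : α ≤ 1) (hθ : Real.exp (-(α * δ₀)) * g.L ^ ((2 * dd : ℝ) / N) < 1) :
    B6RandomWalk.Ineq260 g δ₀ α ∧ B6Lemma21Repaired.Ineq261With (K261 N dd g.L A (α * δ₀)) g δ₀ α ∧
      B6Lemma21Repaired.Ineq262With (K261 N dd g.L A (α * δ₀)) g δ₀ α ∧
      B6Lemma21Repaired.Ineq263With (K261 N dd g.L A (α * δ₀)) g δ₀ α :=
  lemma21_of_realizes (ℓ := fun j => g.L ^ j * g.eta) hreal hι hconn (levelGap_of_cond22 pos hL hη.le hlen h22 hRM.le)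
    hN hRM.ge hlen (fun _ _ hab => mul_le_mul_of_nonneg_right (pow_le_pow_right₀ hL hab) hη.le)
    (fun n => mul_pos (pow_pos (by linarith) n) hη) (fun n => le_of_eq (by ring)) hL hA hpack hδ₀ hα0 hα1 hθ

/-- **Lemma 2.1 for a FAMILY of realised geometries with a UNIFORM constant** (the shape of `B6Lemma21Repaired.Lemma21Repaired`:
one statement for all members `geo i` — e.g. the geometries 𝔅_k of the successive renormalization steps — and all admissible
`α`): common `N` (= RM, fixed along the sequence), `dd`, `L`, `A`, per-member bond scales and packing; for every `i`, every
`0 < α ≤ 1` with `e^{−αδ₀}·L^{2dd/N} < 1`: (2.60)–(2.63) for `geo i` with the constant `K261 N dd L A (αδ₀)` (independent of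
`i`). [cite: Balaban1984PropagatorsII, Lemma 2.1 (2.60)–(2.63) p.234, (2.59) p.233] -/
theorem lemma21_family_of_realizes {I : Type*} {geo : I → B6.Geometry} {Cf : ∀ i, ContourSystem (geo i)}
    {Xf : I → Type*} [∀ i, PseudoMetricSpace (Xf i)] {posf : ∀ i, (Cf i).Pt → Xf i} {ℓf : I → ℕ → ℝ} {δ₀ : ℝ}
    (hreal : ∀ i, Realizes (geo i) (Cf i)) (hι : ∀ i, Function.Injective (Cf i).ι)
    (hconn : ∀ i, (Cf i).bond.Connected) (hgap : ∀ i, LevelGap (Cf i).bond (Cf i).zone N) (hN : 0 < N)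
    (hRM : ∀ i, (geo i).R * (geo i).M ≤ N) (hbond : ∀ i, BondScale (Cf i).bond (Cf i).zone (posf i) (ℓf i))
    (hmono : ∀ i, Monotone (ℓf i)) (hℓpos : ∀ i n, 0 < ℓf i n) (hℓL : ∀ i n, ℓf i (n + 1) ≤ Lr * ℓf i n)
    (hLr : 1 ≤ Lr) (hA : 0 ≤ A)
    (hpack : ∀ i (j : ℕ) (p : Xf i) (R : ℝ) (S : Finset (Cf i).Pt), 0 ≤ R →
      (∀ v ∈ S, (Cf i).zone v = j ∧ dist (posf i v) p ≤ R) → (#S : ℝ) ≤ (2 * R / ℓf i j + A) ^ dd)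
    (hδ₀ : 0 ≤ δ₀) :
    ∀ i : I, ∀ α : ℝ, 0 < α → α ≤ 1 → Real.exp (-(α * δ₀)) * Lr ^ ((2 * dd : ℝ) / N) < 1 →
      B6RandomWalk.Ineq260 (geo i) δ₀ α ∧ B6Lemma21Repaired.Ineq261With (K261 N dd Lr A (α * δ₀)) (geo i) δ₀ α ∧
        B6Lemma21Repaired.Ineq262With (K261 N dd Lr A (α * δ₀)) (geo i) δ₀ α ∧
        B6Lemma21Repaired.Ineq263With (K261 N dd Lr A (α * δ₀)) (geo i) δ₀ α :=
  fun i _α hα0 hα1 hθ => lemma21_of_realizes (hreal i) (hι i) (hconn i) (hgap i) hN (hRM i) (hbond i) (hmono i)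
    (hℓpos i) (hℓL i) hLr hA (hpack i) hδ₀ hα0.le hα1 hθ

/-- **Lemma 2.1 for a family, geometric inputs in printed shape** (the shape of
`B6LevelGapMetric.lemma21Printed_of_ineq261_cond22`, with (2.61) now PROVED instead of assumed): members realised by contour
systems with bond lengths `L^jη_i` (`BondScale22`), (2.2) on lattice points (`Cond22`), a common `L ≥ 1` and a common
`RM = N ≥ 1`, `η_i > 0`, uniform packing; conclusion as in `lemma21_family_of_realizes` with constant `K261 N dd L A (αδ₀)`.
[cite: Balaban1984PropagatorsII, Lemma 2.1 (2.60)–(2.63) p.234, (2.2) p.224, p.231, (2.59) p.233] -/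
theorem lemma21_family_of_cond22 {I : Type*} {geo : I → B6.Geometry} {Cf : ∀ i, ContourSystem (geo i)}
    {Xf : I → Type*} [∀ i, PseudoMetricSpace (Xf i)] {posf : ∀ i, (Cf i).Pt → Xf i} {L δ₀ : ℝ}
    (hreal : ∀ i, Realizes (geo i) (Cf i)) (hι : ∀ i, Function.Injective (Cf i).ι)
    (hconn : ∀ i, (Cf i).bond.Connected) (hLi : ∀ i, (geo i).L = L) (hL : 1 ≤ L) (hη : ∀ i, 0 < (geo i).eta)
    (hlen : ∀ i, BondScale22 (Cf i) (posf i)) (h22 : ∀ i, Cond22 (Cf i) (posf i)) (hN : 0 < N)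
    (hRM : ∀ i, (N : ℝ) = (geo i).R * (geo i).M) (hA : 0 ≤ A)
    (hpack : ∀ i (j : ℕ) (p : Xf i) (R : ℝ) (S : Finset (Cf i).Pt), 0 ≤ R →
      (∀ v ∈ S, (Cf i).zone v = j ∧ dist (posf i v) p ≤ R) → (#S : ℝ) ≤ (2 * R / (L ^ j * (geo i).eta) + A) ^ dd)
    (hδ₀ : 0 ≤ δ₀) :
    ∀ i : I, ∀ α : ℝ, 0 < α → α ≤ 1 → Real.exp (-(α * δ₀)) * L ^ ((2 * dd : ℝ) / N) < 1 →
      B6RandomWalk.Ineq260 (geo i) δ₀ α ∧ B6Lemma21Repaired.Ineq261With (K261 N dd L A (α * δ₀)) (geo i) δ₀ α ∧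
        B6Lemma21Repaired.Ineq262With (K261 N dd L A (α * δ₀)) (geo i) δ₀ α ∧
        B6Lemma21Repaired.Ineq263With (K261 N dd L A (α * δ₀)) (geo i) δ₀ α := by
  intro i α hα0 hα1 hθ
  have hL' : 1 ≤ (geo i).L := by rw [hLi i]; exact hL
  have h := lemma21_of_cond22 (dd := dd) (A := A) (hreal i) (hι i) (hconn i) hL' (hη i) (hlen i) (h22 i) hN (hRM i) hA
    (by simpa only [hLi i] using hpack i) hδ₀ hα0.le hα1 (by simpa only [hLi i] using hθ)
  simpa only [hLi i] using h

end Lemma21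

section Lemma21Cube

open B15Ineq147LevelGap

variable {d : ℕ} {M₁ L : ℕ} {Z : ℕ → Set (Fin d → ℤ)}

/-- **Lemma 2.1 — all four displays — for a geometry realised by ANY bond graph on the cube-sites `CubeSite M₁ L Z` whose bonds
stay within the coarser scale** (touching cubes of equal or consecutive scales qualify), given its walk form `LevelGap G zoneC N`
(`N ≥ 1`, `RM ≤ N`) and connectedness: constant `K261 N d L 1 (αδ₀)` under `e^{−αδ₀}·L^{2d/N} < 1` (packing by `pack_cube`).
[cite: Balaban1984PropagatorsII, Lemma 2.1 (2.60)–(2.63) p.234; Balaban1989LargeFieldI, p.179, p.186] -/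
theorem lemma21_cubeSites {g : B6.Geometry} {N : ℕ} {δ₀ α : ℝ} (G : SimpleGraph (CubeSite M₁ L Z))
    (ι : g.Site → CubeSite M₁ L Z) (hι : Function.Injective ι) (hzone : ∀ y, zoneC (ι y) = g.scale y)
    (hdist : ∀ y y', g.dist y y' = (G.dist (ι y) (ι y') : ℝ)) (hconn : G.Connected) (hgap : LevelGap G zoneC N)
    (hN : 0 < N) (hRM : g.R * g.M ≤ N)
    (hadj : ∀ ⦃s t : CubeSite M₁ L Z⦄, G.Adj s t → dist (posC s) (posC t) ≤ scaleC M₁ L (max (zoneC s) (zoneC t)))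
    (hM₁ : 0 < M₁) (hL : 1 ≤ L) (hδ₀ : 0 ≤ δ₀) (hα0 : 0 ≤ α) (hα1 : α ≤ 1)
    (hθ : Real.exp (-(α * δ₀)) * (L : ℝ) ^ ((2 * d : ℝ) / N) < 1) :
    B6RandomWalk.Ineq260 g δ₀ α ∧ B6Lemma21Repaired.Ineq261With (K261 N d L 1 (α * δ₀)) g δ₀ α ∧
      B6Lemma21Repaired.Ineq262With (K261 N d L 1 (α * δ₀)) g δ₀ α ∧
      B6Lemma21Repaired.Ineq263With (K261 N d L 1 (α * δ₀)) g δ₀ α := by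
  let C : ContourSystem g := ⟨CubeSite M₁ L Z, G, ι, zoneC, hzone⟩
  have hreal : Realizes g C := fun y y' => hdist y y'
  exact lemma21_of_realizes_max (C := C) (pos := posC) (ℓ := scaleC M₁ L) hreal hι hconn hgap hN hRM hadj
    (scaleC_mono hL) (scaleC_pos hM₁ (by omega)) (scaleC_succ_le M₁ L) (by exact_mod_cast hL) zero_le_one
    (fun j p R S hR hS => pack_cube hM₁ (by omega) j p R S hR hS) hδ₀ hα0 hα1 hθ

/-- **Lemma 2.1 — all four displays — for every geometry realised by a ℤᵈ nested-cube contour system** of `B15Ineq147LevelGap`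
(bonds `bondC`, nested `Z″_n` separated by one layer of `ML^{n+1}`-cubes, `L ≥ 2`, `M₁ ∣ M`, `RM ≤ M/M₁`): constant
`K261 (M/M₁) d L 1 (αδ₀)` under `e^{−αδ₀}·L^{2d/(M/M₁)} < 1`. [cite: Balaban1984PropagatorsII, Lemma 2.1 (2.60)–(2.63) p.234, (2.2) p.224; Balaban1989LargeFieldI, p.179, p.186] -/
theorem lemma21_cube {g : B6.Geometry} {M : ℕ} {δ₀ α : ℝ} (ι : g.Site → CubeSite M₁ L Z) (hι : Function.Injective ι)
    (hzone : ∀ y, zoneC (ι y) = g.scale y)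
    (hdist : ∀ y y', g.dist y y' = ((bondC M₁ L Z).dist (ι y) (ι y') : ℝ))
    (hconn : (bondC M₁ L Z).Connected) (hmono : Monotone Z) (hsep : LayerSepZd Z M L) (hM : 0 < M) (hM₁ : 0 < M₁)
    (hdvd : M₁ ∣ M) (hMM₁ : M₁ ≤ M) (hL : 2 ≤ L) (hRM : g.R * g.M ≤ (M / M₁ : ℕ))
    (hδ₀ : 0 ≤ δ₀) (hα0 : 0 ≤ α) (hα1 : α ≤ 1)
    (hθ : Real.exp (-(α * δ₀)) * (L : ℝ) ^ ((2 * d : ℝ) / (M / M₁ : ℕ)) < 1) :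
    B6RandomWalk.Ineq260 g δ₀ α ∧ B6Lemma21Repaired.Ineq261With (K261 (M / M₁) d L 1 (α * δ₀)) g δ₀ α ∧
      B6Lemma21Repaired.Ineq262With (K261 (M / M₁) d L 1 (α * δ₀)) g δ₀ α ∧
      B6Lemma21Repaired.Ineq263With (K261 (M / M₁) d L 1 (α * δ₀)) g δ₀ α := by
  let C : ContourSystem g := ⟨CubeSite M₁ L Z, bondC M₁ L Z, ι, zoneC, hzone⟩
  have hreal : Realizes g C := fun y y' => hdist y y'
  have hN : 0 < M / M₁ := Nat.div_pos hMM₁ hM₁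
  exact lemma21_of_realizes (C := C) (pos := posC) (ℓ := scaleC M₁ L) hreal hι hconn
    (levelGap_cube hmono hsep hM hM₁ hdvd hL) hN hRM bondScale_cube (scaleC_mono (by omega))
    (scaleC_pos hM₁ (by omega)) (scaleC_succ_le M₁ L) (by exact_mod_cast (show 1 ≤ L by omega)) zero_le_one
    (fun j p R S hR hS => pack_cube hM₁ (by omega) j p R S hR hS) hδ₀ hα0 hα1 hθ

end Lemma21Cube

/-! ## §11 (v1.3, append-only). Monotonicity in `N` and in the rate: UNIFORM constants for families -/

section Mono

/-- The walk form of (2.2) is ANTITONE in the bond count: `LevelGap N` ⇒ `LevelGap N′` for `N′ ≤ N` (so a family with member-dependent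
`N_i ≥ N₀` — e.g. `R_iM_i ≥ N₀` — satisfies `LevelGap N₀` uniformly). [cite: Balaban1984PropagatorsII, (2.2) p.224, (2.57) p.233] -/
theorem levelGap_of_le {V : Type*} {G : SimpleGraph V} {zone : V → ℕ} {N N' : ℕ} (hgap : LevelGap G zone N) (hle : N' ≤ N) :
    LevelGap G zone N' :=
  fun _ _ _ hu hx p => le_trans (Nat.succ_le_succ hle) (hgap hu hx p)

/-- The shell count is ANTITONE in `N` (`L ≥ 1`, `A ≥ 0`): a larger level gap shrinks the zone window. [cite: Balaban1984PropagatorsII, (2.58)–(2.59) p.233] -/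
theorem F261_anti_N {N N' dd : ℕ} {Lr A : ℝ} (hLr : 1 ≤ Lr) (hA : 0 ≤ A) (hN : 0 < N) (hle : N ≤ N') (r : ℕ) :
    F261 N' dd Lr A r ≤ F261 N dd Lr A r := by
  unfold F261
  have hdiv : r / N' ≤ r / N := Nat.div_le_div_left hle hN
  have h1 : (2 * ((r / N' + 1 : ℕ) : ℝ) + 1) ≤ (2 * ((r / N + 1 : ℕ) : ℝ) + 1) := by
    have : ((r / N' + 1 : ℕ) : ℝ) ≤ ((r / N + 1 : ℕ) : ℝ) := by exact_mod_cast Nat.succ_le_succ hdiv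
    linarith
  have h2 : Lr ^ (2 * (r / N' + 1)) ≤ Lr ^ (2 * (r / N + 1)) := pow_le_pow_right₀ hLr (by omega)
  have hr : (0 : ℝ) ≤ 2 * (r : ℝ) := by positivity
  have h3 : (2 * (r : ℝ) * Lr ^ (2 * (r / N' + 1)) + A) ^ dd ≤ (2 * (r : ℝ) * Lr ^ (2 * (r / N + 1)) + A) ^ dd :=
    pow_le_pow_left₀ (by positivity) (by nlinarith [mul_le_mul_of_nonneg_left h2 hr]) dd
  exact mul_le_mul h1 h3 (by positivity) (by positivity)

/-- **The (2.61) constant is ANTITONE in `N`**: `K261 N′ … σ ≤ K261 N … σ` for `N ≤ N′` (under the summability condition at `N`).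
[cite: Balaban1984PropagatorsII, Lemma 2.1 (2.61) p.234, (2.59) p.233] -/
theorem K261_anti_N {N N' dd : ℕ} {Lr A σ : ℝ} (hN : 0 < N) (hle : N ≤ N') (hLr : 1 ≤ Lr) (hA : 0 ≤ A)
    (hθ : Real.exp (-σ) * Lr ^ ((2 * dd : ℝ) / N) < 1) :
    K261 N' dd Lr A σ ≤ K261 N dd Lr A σ := by
  have hsum := summable_K261 hN hLr hA hθ
  have hle' : ∀ r : ℕ, Real.exp (-(σ * r)) * F261 N' dd Lr A r ≤ Real.exp (-(σ * r)) * F261 N dd Lr A r := fun r =>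
    mul_le_mul_of_nonneg_left (F261_anti_N hLr hA hN hle r) (Real.exp_nonneg _)
  have hnn : ∀ r : ℕ, 0 ≤ Real.exp (-(σ * r)) * F261 N' dd Lr A r := fun r =>
    mul_nonneg (Real.exp_nonneg _) (F261_nonneg (by linarith) hA r)
  have hsum' : Summable (fun r : ℕ => Real.exp (-(σ * r)) * F261 N' dd Lr A r) :=
    Summable.of_nonneg_of_le hnn hle' hsum
  exact hsum'.tsum_le_tsum hle' hsum

/-- **The (2.61) constant is ANTITONE in the rate**: `K261 … σ′ ≤ K261 … σ` for `σ ≤ σ′` (under the summability condition at `σ`) —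
print's «c₁(α)» decreases as α grows. [cite: Balaban1984PropagatorsII, Lemma 2.1 (2.61) p.234] -/
theorem K261_anti_sigma {N dd : ℕ} {Lr A σ σ' : ℝ} (hσ : σ ≤ σ') (hN : 0 < N) (hLr : 1 ≤ Lr) (hA : 0 ≤ A)
    (hθ : Real.exp (-σ) * Lr ^ ((2 * dd : ℝ) / N) < 1) :
    K261 N dd Lr A σ' ≤ K261 N dd Lr A σ := by
  have hsum := summable_K261 hN hLr hA hθ
  have hle' : ∀ r : ℕ, Real.exp (-(σ' * r)) * F261 N dd Lr A r ≤ Real.exp (-(σ * r)) * F261 N dd Lr A r := fun r =>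
    mul_le_mul_of_nonneg_right (Real.exp_le_exp.mpr (by nlinarith [Nat.cast_nonneg (α := ℝ) r]))
      (F261_nonneg (by linarith) hA r)
  have hnn : ∀ r : ℕ, 0 ≤ Real.exp (-(σ' * r)) * F261 N dd Lr A r := fun r =>
    mul_nonneg (Real.exp_nonneg _) (F261_nonneg (by linarith) hA r)
  have hsum' : Summable (fun r : ℕ => Real.exp (-(σ' * r)) * F261 N dd Lr A r) :=
    Summable.of_nonneg_of_le hnn hle' hsum
  exact hsum'.tsum_le_tsum hle' hsum

/-- The summability condition is itself monotone: `θ(σ′, N′) ≤ θ(σ, N)` for `σ ≤ σ′`, `N ≤ N′` (`L ≥ 1`), so the condition at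
`(σ, N)` implies it at `(σ′, N′)`. [cite: Balaban1984PropagatorsII, (2.59) p.233] -/
theorem theta_mono {N N' dd : ℕ} {Lr σ σ' : ℝ} (hσ : σ ≤ σ') (hN : 0 < N) (hle : N ≤ N') (hLr : 1 ≤ Lr) :
    Real.exp (-σ') * Lr ^ ((2 * dd : ℝ) / N') ≤ Real.exp (-σ) * Lr ^ ((2 * dd : ℝ) / N) := by
  have hN0 : (0 : ℝ) < N := by exact_mod_cast hN
  have hNN : (N : ℝ) ≤ N' := by exact_mod_cast hle
  have hexp : Real.exp (-σ') ≤ Real.exp (-σ) := Real.exp_le_exp.mpr (by linarith)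
  have hdiv : (2 * dd : ℝ) / N' ≤ (2 * dd : ℝ) / N :=
    div_le_div_of_nonneg_left (by positivity) hN0 hNN
  have hpow : Lr ^ ((2 * dd : ℝ) / N') ≤ Lr ^ ((2 * dd : ℝ) / N) := Real.rpow_le_rpow_of_exponent_le hLr hdiv
  exact mul_le_mul hexp hpow (by positivity) (Real.exp_nonneg _)

variable {g : B6.Geometry} {C : ContourSystem g} {X : Type*} [PseudoMetricSpace X] {pos : C.Pt → X} {ℓ : ℕ → ℝ}
  {N dd : ℕ} {Lr A : ℝ}

/-- **(2.61) with a constant UNIFORM over level gaps `N′ ≥ N` and rates `σ′ ≥ σ`**: a realised contour system with `LevelGap N′`,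
`N ≤ N′`, at any rate `σ′ ≥ σ` has `RowSum g σ′ (K261 N dd L A σ)` under the condition at `(σ, N)` — one constant for a whole family
(members `k` with `R_kM_k ≥ N`, all rates `αδ₀ ≥ σ`), as print's single `c₁(α)`. [cite: Balaban1984PropagatorsII, Lemma 2.1 (2.61) p.234, (2.59) p.233] -/
theorem rowSum_K261_uniform {N' : ℕ} {σ σ' : ℝ} (hreal : Realizes g C) (hι : Function.Injective C.ι) (hconn : C.bond.Connected)
    (hgap : LevelGap C.bond C.zone N') (hN : 0 < N) (hle : N ≤ N') (hσ : σ ≤ σ') (hbond : BondScale C.bond C.zone pos ℓ)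
    (hmono : Monotone ℓ) (hℓpos : ∀ n, 0 < ℓ n) (hℓL : ∀ n, ℓ (n + 1) ≤ Lr * ℓ n) (hLr : 1 ≤ Lr) (hA : 0 ≤ A)
    (hpack : ∀ (j : ℕ) (p : X) (R : ℝ) (S : Finset C.Pt), 0 ≤ R → (∀ v ∈ S, C.zone v = j ∧ dist (pos v) p ≤ R) →
      (#S : ℝ) ≤ (2 * R / ℓ j + A) ^ dd)
    (hθ : Real.exp (-σ) * Lr ^ ((2 * dd : ℝ) / N) < 1) :
    RowSum g σ' (K261 N dd Lr A σ) :=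
  (rowSum_K261_of_realizes (dd := dd) hreal hι hconn (levelGap_of_le hgap hle) hN hbond hmono hℓpos hℓL hLr hA hpack
    hθ).mono (dist_nonneg_of_realizes hreal) hσ

end Mono

end

end Literature.MathematicalPhysics.QuantumFieldTheory.Balaban1983to89.B6Ineq261LevelGap
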